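import Literature.NumberTheory.Automorphic.GaloisActionAdeleRing
import Literature.NumberTheory.Automorphic.GLnCuspidalSpectrum
import Literature.NumberTheory.Automorphic.AdeleRingTopology
import Literature.NumberTheory.Automorphic.Sweep1Proofs
import HarnessLib

/-!
# Galois conjugation of automorphic representations of `GL_n(𝔸_E)`: `Π^σ`

Topic `NumberTheory/Automorphic`; namespaces `Literature.Automorphic`, `ContRepresentation.ClosedSubrep`
(generic transport, deliberate dot-notation extensions of the tree's `ClosedSubrep`) and
`Literature.Lang` (base change). For a number field `E`, `σ ∈ Aut(E/F) = E ≃ₐ[F] E` acting on `𝔸_E`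
(`GaloisActionAdeleRing`), this file constructs — everything **proved** except the one named
fact at the end —

* the entrywise action of `σ` on `GL_n(𝔸_E)` (`MulDistribMulAction`, generic for a monoid acting
  on a commutative ring), continuous, preserving the diagonal `GL_n(E)` (`GLn.smul_toAdelic`),
  the split centre `A_G` (`GLn.smul_posRealScalar`, from `σ • z(t) = z(t)` for the diagonal real
  scalars, `InfiniteAdeleRing.smul_realToInfiniteAdele`, a density-of-`ℚ` argument), hence
  `A_G GL_n(E)` (`GLn.smul_mem_quotientSubgroup_iff`); its effect on local components
  (`GLn.toLocal_smul(_smul)`), on the local embeddings `ι_w` (`GLn.smul_ofLocal`), on the levels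
  `K^max`, `K(𝔑)` (`GLn.smul_mem_glIntegralLevel_iff`,
  `GLn.smul_mem_principalCongruenceLevel_iff : σ • g ∈ K(σ 𝔑) ↔ g ∈ K(𝔑)`, `idealRadius_smul`)
  and on the Hecke elements (`GLn.smul_heckeDiagAt : σ • t_{w,i}(ϖ) = t_{σ w,i}(σ_w ϖ)`);
* the action on the automorphic quotient `GL_n(𝔸_E) ⧸ A_G GL_n(E)` (`MulAction` instance,
  `σ • [g] = [σ g]`, `σ • (g • x) = σ g • σ • x`, continuous, measurable); push-forwards of
  automorphic measures are automorphic (`isAutomorphicMeasure_map_gal_smul`), and automorphic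
  measures are `Aut(E/F)`-invariant (`IsGalInvariant`) granted their uniqueness up to scalar
  (`isGalInvariant_of_unique`, from the named fact `isAutomorphicMeasure_unique_smul` of
  `AdelicGroupData`, comparing total masses);
* generic transport of closed subrepresentations along a *conjugate-equivariant* isomorphism
  `e (π g v) = π' (θ g) (e v)` (`IsConjEquivariant`, `mapConj`, `mapConjOrderIso`,
  `isTopIrreducible_mapConj_iff`, `mapConjEquiv`, `mapConjEquiv_mem_fixedVectors_iff`, and
  `heckeOperatorAt_mapConj_mapConjEquiv : [θK θg θK] (e f) = e ([KgK] f)` on `K`-fixed vectors);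
* `σ` on `L²(ν)` for `Gal`-invariant `ν`: the unitary `galL2 … σ = U_σ`, `(U_σ f)(x) = f (σ⁻¹ • x)`
  (Mathlib `Lp.compMeasurePreservingₗᵢ`; a left action, `U_σ U_τ = U_{σ τ}`), with
  `U_σ R(g) = R(σ g) U_σ` (`galL2_rightRegular`), whence the **Galois conjugate** `U_σ(W)` of a
  closed subrepresentation of `L²` (`ClosedSubrep.galConj`; action laws, injectivity,
  irreducibility). **Convention:** `U_σ(W) ≅ W ∘ σ⁻¹`, which is `Π^{σ⁻¹}` in Arthur–Clozel's
  notation `Π^σ(g) := Π(σ g)` (Ch. 1 §2.1); the Galois orbit and stability under all of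
  `Aut(E/F)` — the only forms used in statements — do not depend on the convention;
* cusp forms are preserved (`ConstantTermVanishes.comp_gal_smul`: the change of variables
  `X ↦ σ X` on `𝔫_k(𝔸_E)` maps Haar measures to Haar measures and fundamental domains of `𝔫_k(E)`
  to fundamental domains; `galL2_mem_cuspidalSubspace`), so that
  **`CuspidalAutomorphicRepGL.galConj P hν σ = Π^σ`** is a cuspidal automorphic representation,
  with `IsGalStable` (`Π^σ = Π`, Arthur–Clozel's "`σ`-stable");
* Satake parameters: `HasSatakeParameterAt.galConj(_principalCongruenceLevel)` —
  `t_{U_σ(Π), σ w} = t_{Π, w}` (level `σ K`, uniformizer `σ_w ϖ`, `q_{σ w} = q_w`) — and its descent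
  form `of_galConj`; hence **Galois conjugates of weak base-change lifts are weak base-change
  lifts** (`Literature.NumberTheory.Automorphic.IsWeakBaseChangeLift.galConj`, `isWeakBaseChangeLift_galConj_iff`; the case
  `τ ∈ Gal(E/F)` of Arthur–Clozel, Ch. 3, Prop. 4.4 (iii)), using `(σ w) ∩ 𝓞 F = w ∩ 𝓞 F` and
  `f(σ w | v) = f(w | v)` from `GaloisActionPlaces`;
* the **named fact** `Literature.NumberTheory.Automorphic.ArthurClozel1989_exists_cuspidal_descent_of_isGalStable`
  (Arthur–Clozel, Ch. 3, Thm. 4.2 (d), existence half: a `σ`-stable cuspidal `Π` on `GL_n(𝔸_E)`,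
  `E/F` cyclic of prime degree, is a weak lift of some cuspidal `π` on `GL_n(𝔸_F)`), now
  statable; its proof in print is the trace-formula comparison (4.1) = (4.2).

The `σ`-stability of cuspidal weak lifts (Thm. 4.2 (a)) is proved in the forthcoming sibling
`AutomorphicGaloisConjBaseChange` (it needs strong multiplicity one through `UnramifiedHeckeLevel`).

Design notes.
* `galL2` composes with `σ⁻¹` so that `U_σ [φ] = [φ ∘ σ⁻¹]` and `U_σ U_τ = U_{σ τ}`; the
  hypothesis is `IsGalInvariant F ν` (every `σ` measure preserving), supplied by
  `isGalInvariant_of_unique`.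
* Statements about elements of `GL_n(𝔸_E)` are made at the Mathlib type
  `GL (Fin n) (AdeleRing (𝓞 E) E)`; the bridging instances `instMulDistribMulActionGlAdelic/Rational`
  re-expose the action on the carriers `(gl n E).Adelic/Rational` of the adelic datum, which
  instance search does not unfold.
* `heckeOperator_eq_zero_of_infinite_orbit` repeats (as a `private` theorem) the 12-line
  junk-case lemma of `JacquetLanglandsParts` to avoid importing the quaternionic files (librarian
  note in its docstring). The coset-space lemmas `quotientMapOfMulEquiv*` and the Hecke transport
  lemma are in `Literature.Automorphic` (pure group/representation theory).
* New instances: `instMulDistribMulActionGeneralLinearGroup` (+ the two bridges),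
  `instT2SpaceInfiniteAdeleRing`, `instMulActionGalAutomorphicQuotient`,
  `instContinuousConstSMulGalAutomorphicQuotient`; none duplicates a Mathlib instance.
* No `sorry`; one named fact (`ArthurClozel1989_exists_cuspidal_descent_of_isGalStable`).

## References

* J. Arthur, L. Clozel, *Simple algebras, base change, and the advanced theory of the trace
  formula*, Ann. of Math. Stud. 120 (1989), Ch. 1 §2.1 (`Π^σ(g) = Π(σ g)`, `σ`-stable); Ch. 3:
  §1 ((1.1), Def. 1.1), Thm. 4.2 (a) ("`σ`-stable"), (d), Prop. 4.4 (iii). [ArthurClozelAMS120]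
* J. W. S. Cassels, A. Fröhlich (eds.), *Algebraic Number Theory* (1967), Ch. VII §1.1.
  [CasselsFrohlichANT1967]
* R. P. Langlands, *Base change for GL(2)*, Ann. of Math. Stud. 96 (1980), §1 (background).
  [LanglandsBaseChange1980]
-/

noncomputable section

open IsDedekindDomain MonoidWithZeroHom MonoidWithZeroHom.ValueGroup₀ WithZero
open scoped Pointwise

namespace Literature.NumberTheory.Automorphic

/-! ## Galois conjugation on `GL_n(𝔸_E)` and on its automorphic quotient -/

section GeneralLinearGroup

variable {G R : Type*} [Monoid G] [CommRing R] [MulSemiringAction G R] {m : Type*} [Fintype m]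
  [DecidableEq m]

/-- A monoid acting on a commutative ring by ring endomorphisms acts on `GL_m(R)` entrywise
(Mathlib `Matrix.GeneralLinearGroup.map` of `MulSemiringAction.toRingHom`). A new instance (no
Mathlib action of this type exists). [folklore] -/
instance instMulDistribMulActionGeneralLinearGroup : MulDistribMulAction G (GL m R) where
  smul g A := Matrix.GeneralLinearGroup.map (MulSemiringAction.toRingHom G R g) A
  one_smul A := Matrix.GeneralLinearGroup.ext fun i j => one_smul G ((A : Matrix m m R) i j)
  mul_smul g h A := Matrix.GeneralLinearGroup.ext fun i j => mul_smul g h ((A : Matrix m m R) i j)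
  smul_mul g A B := map_mul (Matrix.GeneralLinearGroup.map (MulSemiringAction.toRingHom G R g)) A B
  smul_one g := map_one (Matrix.GeneralLinearGroup.map (MulSemiringAction.toRingHom G R g))

/-- Entries of `g • A`: `(g • A)ᵢⱼ = g • Aᵢⱼ` (definitional). [folklore] -/
@[simp] theorem GeneralLinearGroup.coe_smul_apply (g : G) (A : GL m R) (i j : m) :
    ((g • A : GL m R) : Matrix m m R) i j = g • (A : Matrix m m R) i j := rfl

/-- `g • A = GeneralLinearGroup.map (g : R →+* R) A` (definitional). [folklore] -/
theorem GeneralLinearGroup.smul_def (g : G) (A : GL m R) :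
    g • A = Matrix.GeneralLinearGroup.map (MulSemiringAction.toRingHom G R g) A := rfl

/-- The action commutes with `GeneralLinearGroup.map` along equivariant ring homomorphisms.
[folklore] -/
theorem GeneralLinearGroup.smul_map {S : Type*} [CommRing S] [MulSemiringAction G S] (f : R →+* S)
    (hf : ∀ (g : G) (x : R), f (g • x) = g • f x) (g : G) (A : GL m R) :
    g • Matrix.GeneralLinearGroup.map f A = Matrix.GeneralLinearGroup.map f (g • A) :=
  Matrix.GeneralLinearGroup.ext fun i j => (hf g ((A : Matrix m m R) i j)).symm

/-- The action on `GL_m(R)` is by homeomorphisms when `G` acts continuously on a topological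
ring `R`. [folklore] -/
theorem GeneralLinearGroup.continuous_smul [TopologicalSpace R] [IsTopologicalRing R]
    [ContinuousConstSMul G R] (g : G) : Continuous (fun A : GL m R => g • A) :=
  (show Continuous (MulSemiringAction.toRingHom G R g) from continuous_const_smul g).generalLinearGroup_map

end GeneralLinearGroup

section GLnAdelic

open NumberField AdelicGroupData

variable (F : Type*) [Field F] {E : Type} [Field E] [NumberField E] [Algebra F E] {n : ℕ}

/-- The entrywise action of `Aut(E/F)` on `GL_n(𝔸_E)`, on the carrier `(gl n E).Adelic` of the
adelic group datum (the same instance as on `GL (Fin n) (AdeleRing (𝓞 E) E)`, re-exposed through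
the structure projection, which instance search does not unfold). [folklore] -/
instance instMulDistribMulActionGlAdelic : MulDistribMulAction (E ≃ₐ[F] E) (gl n E).Adelic :=
  inferInstanceAs (MulDistribMulAction (E ≃ₐ[F] E) (GL (Fin n) (AdeleRing (𝓞 E) E)))

/-- The entrywise action of `Aut(E/F)` on `GL_n(E)`, on the carrier `(gl n E).Rational`. [folklore] -/
instance instMulDistribMulActionGlRational : MulDistribMulAction (E ≃ₐ[F] E) (gl n E).Rational :=
  inferInstanceAs (MulDistribMulAction (E ≃ₐ[F] E) (GL (Fin n) E))

/-- `σ • (γ)_𝔸 = (σ • γ)_𝔸` for `γ ∈ GL_n(E)`: the diagonal embedding is equivariant. [folklore] -/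
theorem GLn.smul_toAdelic (σ : E ≃ₐ[F] E) (γ : GL (Fin n) E) :
    σ • (gl n E).toAdelic γ = (gl n E).toAdelic (σ • γ) :=
  GeneralLinearGroup.smul_map (algebraMap E (AdeleRing (𝓞 E) E))
    (fun τ x => (AdeleRing.smul_algebraMap F τ x).symm) σ γ

omit [NumberField E] [Algebra F E] in
variable {F} in
/-- Continuity of the diagonal real scalars `ℝ → E_∞` (via the homeomorphism
`E_∞ ≃ₜ ℝ^{r₁} × ℂ^{r₂}` of `AdeleRingTopology`). [folklore] -/
theorem continuous_realToInfiniteAdele' : Continuous (realToInfiniteAdele E) :=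
  (infiniteAdeleRingHomeomorph E).symm.continuous.comp (continuous_algebraMap ℝ _)

omit [NumberField E] [Algebra F E] in
variable {F} in
/-- `E_∞` is Hausdorff (a finite product of normed fields). [folklore] -/
instance instT2SpaceInfiniteAdeleRing : T2Space (InfiniteAdeleRing E) :=
  inferInstanceAs (T2Space ((v : InfinitePlace E) → v.Completion))

omit [NumberField E] in
/-- **`Aut(E/F)` fixes the diagonal real scalars** `t ∈ ℝ ↪ E_∞`: `σ • z(t) = z(t)`. Both sides
are continuous ring homomorphisms `ℝ → E_∞` that agree on `ℚ` (any two ring homomorphisms out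
of `ℚ` agree), and `ℚ` is dense in `ℝ`. [folklore] -/
theorem InfiniteAdeleRing.smul_realToInfiniteAdele (σ : E ≃ₐ[F] E) (t : ℝ) :
    σ • realToInfiniteAdele E t = realToInfiniteAdele E t := by
  have h1 : Continuous fun s : ℝ => σ • realToInfiniteAdele E s :=
    (InfiniteAdeleRing.continuous_smul F σ).comp continuous_realToInfiniteAdele'
  have hq : (fun s : ℝ => σ • realToInfiniteAdele E s) ∘ (Rat.cast : ℚ → ℝ) =
      (realToInfiniteAdele E) ∘ (Rat.cast : ℚ → ℝ) := by
    have := RingHom.ext_rat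
      (((MulSemiringAction.toRingHom (E ≃ₐ[F] E) (InfiniteAdeleRing E) σ).comp
        (realToInfiniteAdele E)).comp (Rat.castHom ℝ))
      ((realToInfiniteAdele E).comp (Rat.castHom ℝ))
    exact congrArg (fun f : ℚ →+* InfiniteAdeleRing E => (f : ℚ → InfiniteAdeleRing E)) this
  exact congrFun (Rat.denseRange_cast.equalizer h1 continuous_realToInfiniteAdele' hq) t

/-- **`Aut(E/F)` fixes the split centre `A_G`**: `σ • (t · 1ₙ) = t · 1ₙ` for the positive real
scalar matrices `posRealScalar`. [folklore] -/
@[simp] theorem GLn.smul_posRealScalar (σ : E ≃ₐ[F] E) (t : NNRealˣ) :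
    σ • posRealScalar n E t = posRealScalar n E t := by
  refine Matrix.GeneralLinearGroup.ext fun i j => ?_
  rw [GeneralLinearGroup.coe_smul_apply]
  change σ • ((Matrix.GeneralLinearGroup.scalar (Fin n) (posRealIdele E t) :
    Matrix (Fin n) (Fin n) (AdeleRing (𝓞 E) E)) i j) =
    ((Matrix.GeneralLinearGroup.scalar (Fin n) (posRealIdele E t) :
      Matrix (Fin n) (Fin n) (AdeleRing (𝓞 E) E)) i j)
  rw [Matrix.GeneralLinearGroup.coe_scalar, Matrix.scalar_apply]
  by_cases hij : i = j
  · subst hij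
    rw [Matrix.diagonal_apply_eq]
    refine Prod.ext ?_ ?_
    · rw [AdeleRing.smul_fst, posRealIdele_fst, InfiniteAdeleRing.smul_realToInfiniteAdele]
    · rw [AdeleRing.smul_snd, posRealIdele_snd, smul_one]
  · rw [Matrix.diagonal_apply_ne _ hij, smul_zero]

/-- `A_G` is a normal subgroup of `GL_n(𝔸_E)` (it is central). [folklore] -/
theorem GLn.center'_normal : ((gl n E).center').Normal :=
  ⟨fun a ha g => by
    rw [Subgroup.mem_center_iff.mp ((gl n E).center'_le ha) g, mul_inv_cancel_right]; exact ha⟩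

/-- **`Aut(E/F)` preserves `A_G · GL_n(E)`**: `σ • x ∈ A_G GL_n(E)` for `x ∈ A_G GL_n(E)`. [folklore] -/
theorem GLn.smul_mem_quotientSubgroup (σ : E ≃ₐ[F] E) {x : (gl n E).Adelic}
    (hx : x ∈ (gl n E).quotientSubgroup) : σ • x ∈ (gl n E).quotientSubgroup := by
  haveI := GLn.center'_normal (E := E) (n := n)
  have hx' : x ∈ (((gl n E).center' ⊔ (gl n E).arithmeticSubgroup : Subgroup (gl n E).Adelic) :
      Set (gl n E).Adelic) := hx
  rw [Subgroup.normal_mul] at hx'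
  obtain ⟨a, ha, b, hb, rfl⟩ := hx'
  obtain ⟨t, rfl⟩ := ha
  obtain ⟨γ, rfl⟩ := hb
  rw [smul_mul']
  refine mul_mem ((gl n E).center'_le_quotientSubgroup ⟨t, ?_⟩)
    ((gl n E).arithmeticSubgroup_le_quotientSubgroup ⟨σ • γ, ?_⟩)
  · exact (GLn.smul_posRealScalar F σ t).symm
  · exact (GLn.smul_toAdelic F σ γ).symm

/-- `σ • x ∈ A_G GL_n(E) ↔ x ∈ A_G GL_n(E)`. [folklore] -/
theorem GLn.smul_mem_quotientSubgroup_iff (σ : E ≃ₐ[F] E) (x : (gl n E).Adelic) :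
    σ • x ∈ (gl n E).quotientSubgroup ↔ x ∈ (gl n E).quotientSubgroup :=
  ⟨fun h => by simpa only [inv_smul_smul] using GLn.smul_mem_quotientSubgroup F σ⁻¹ h,
    GLn.smul_mem_quotientSubgroup F σ⟩

/-- Each `σ` acts continuously on `GL_n(𝔸_E)`. [folklore] -/
theorem GLn.continuous_smul (σ : E ≃ₐ[F] E) :
    Continuous (fun g : GL (Fin n) (AdeleRing (𝓞 E) E) => σ • g) :=
  GeneralLinearGroup.continuous_smul σ

/-! ### Local components, local embeddings, levels and Hecke elements under `σ` -/

/-- **Local components of `σ • g`**: `(σ • g)_w = σ_w(g_{σ⁻¹ w})` entrywise, i.e.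
`toLocal w (σ • g) = GL_n(galAdicCompletionMap σ) (toLocal (σ⁻¹ w) g)`. [folklore] -/
theorem GLn.toLocal_smul (σ : E ≃ₐ[F] E) (w : HeightOneSpectrum (𝓞 E))
    (g : GL (Fin n) (AdeleRing (𝓞 E) E)) :
    (gl n E).toLocal w (σ • g) =
      Matrix.GeneralLinearGroup.map (galAdicCompletionMap σ (smul_inv_smul σ w))
        ((gl n E).toLocal (σ⁻¹ • w) g) :=
  Matrix.GeneralLinearGroup.ext fun _ _ => rfl

/-- Local components at `σ w`: `(σ • g)_{σ w} = σ_w(g_w)`. [folklore] -/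
theorem GLn.toLocal_smul_smul (σ : E ≃ₐ[F] E) (w : HeightOneSpectrum (𝓞 E))
    (g : GL (Fin n) (AdeleRing (𝓞 E) E)) :
    (gl n E).toLocal (σ • w) (σ • g) =
      Matrix.GeneralLinearGroup.map (galAdicCompletionMap σ rfl) ((gl n E).toLocal w g) :=
  Matrix.GeneralLinearGroup.ext fun i j => by
    change (σ • ((g : Matrix (Fin n) (Fin n) (AdeleRing (𝓞 E) E)) i j)).2 (σ • w) =
      galAdicCompletionMap σ rfl (((g : Matrix (Fin n) (Fin n) (AdeleRing (𝓞 E) E)) i j).2 w)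
    rw [AdeleRing.smul_snd, FiniteAdeleRing.smul_apply_smul]

open scoped Classical in
/-- The factor inclusion `E_w → 𝔸_E^∞` of the tree (`finiteAdeleSingleHom`) is
`FiniteAdeleRing.single`. [folklore] -/
theorem finiteAdeleSingleHom_eq_single (w : HeightOneSpectrum (𝓞 E)) (y : w.adicCompletion E) :
    finiteAdeleSingleHom E w y = FiniteAdeleRing.single w y := by
  refine FiniteAdeleRing.ext E fun u => ?_
  by_cases hu : u = w
  · subst hu; rw [finiteAdeleSingleHom_apply_self, FiniteAdeleRing.single_apply_self]
  · rw [finiteAdeleSingleHom_apply_of_ne E w y hu, FiniteAdeleRing.single_apply_of_ne E y hu]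

/-- `σ` on the factor inclusion `E_w → 𝔸_E`: `σ • ι_w(y) = ι_{σ w}(σ_w y)`. [folklore] -/
theorem smul_adeleSingleHom (σ : E ≃ₐ[F] E) (w : HeightOneSpectrum (𝓞 E)) (y : w.adicCompletion E) :
    σ • adeleSingleHom E w y = adeleSingleHom E (σ • w) (galAdicCompletionMap σ rfl y) := by
  classical
  refine Prod.ext ?_ ?_
  · rw [AdeleRing.smul_fst, adeleSingleHom_apply_fst, adeleSingleHom_apply_fst]
    exact smul_zero σ
  · rw [AdeleRing.smul_snd, adeleSingleHom_apply_snd, adeleSingleHom_apply_snd,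
      finiteAdeleSingleHom_eq_single, finiteAdeleSingleHom_eq_single]
    exact FiniteAdeleRing.smul_single E σ w y

/-- **`σ` on the local embedding** `ι_w : GL_n(E_w) → GL_n(𝔸_E)`:
`σ • ι_w(x) = ι_{σ w}(σ_w x)`. [folklore] -/
theorem GLn.smul_ofLocal (σ : E ≃ₐ[F] E) (w : HeightOneSpectrum (𝓞 E))
    (x : GL (Fin n) (w.adicCompletion E)) :
    σ • GLn.ofLocal n E w x =
      GLn.ofLocal n E (σ • w) (Matrix.GeneralLinearGroup.map (galAdicCompletionMap σ rfl) x) := by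
  refine Matrix.GeneralLinearGroup.ext fun i j => ?_
  rw [GeneralLinearGroup.coe_smul_apply, GLn.coe_ofLocal_apply, GLn.coe_ofLocal_apply, smul_add,
    smul_adeleSingleHom, map_sub]
  congr 1
  · by_cases hij : i = j
    · subst hij; rw [Matrix.one_apply_eq]; exact smul_one σ
    · rw [Matrix.one_apply_ne hij]; exact smul_zero σ
  · congr 1
    change _ = galAdicCompletionMap σ rfl ((x : Matrix (Fin n) (Fin n) (w.adicCompletion E)) i j) -
      (1 : Matrix (Fin n) (Fin n) ((σ • w).adicCompletion E)) i j
    congr 1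
    by_cases hij : i = j
    · subst hij; rw [Matrix.one_apply_eq, Matrix.one_apply_eq, map_one]
    · rw [Matrix.one_apply_ne hij, Matrix.one_apply_ne hij, map_zero]

/-- The valued congruence subgroups correspond under `σ_w : GL_n(E_w) → GL_n(E_{σ w})`
(`σ_w` preserves valuations). [folklore] -/
theorem GLn.map_galAdicCompletionMap_mem_valuedCongruenceSubgroup_iff (σ : E ≃ₐ[F] E)
    {w w' : HeightOneSpectrum (𝓞 E)} (h : σ • w = w') (c : WithZero (Multiplicative ℤ))
    (x : GL (Fin n) (w.adicCompletion E)) :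
    Matrix.GeneralLinearGroup.map (galAdicCompletionMap σ h) x ∈ valuedCongruenceSubgroup (Fin n) c ↔
      x ∈ valuedCongruenceSubgroup (Fin n) c := by
  have hone : ∀ i j : Fin n, (1 : Matrix (Fin n) (Fin n) (w'.adicCompletion E)) i j =
      galAdicCompletionMap σ h ((1 : Matrix (Fin n) (Fin n) (w.adicCompletion E)) i j) := by
    intro i j
    by_cases hij : i = j
    · subst hij; rw [Matrix.one_apply_eq, Matrix.one_apply_eq, map_one]
    · rw [Matrix.one_apply_ne hij, Matrix.one_apply_ne hij, map_zero]
  rw [mem_valuedCongruenceSubgroup_iff, mem_valuedCongruenceSubgroup_iff, ← map_inv]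
  simp only [Matrix.GeneralLinearGroup.map_apply, Matrix.sub_apply, valued_galAdicCompletionMap]
  refine and_congr Iff.rfl (and_congr Iff.rfl (forall₂_congr fun i j => ?_))
  rw [hone i j, ← map_sub, valued_galAdicCompletionMap]

/-- **`σ` preserves the integral level** `K^max = {1} × GL_n(𝒪̂_E)`. [folklore] -/
theorem GLn.smul_mem_glIntegralLevel_iff (σ : E ≃ₐ[F] E) (g : GL (Fin n) (AdeleRing (𝓞 E) E)) :
    σ • g ∈ glIntegralLevel n E ↔ g ∈ glIntegralLevel n E := by
  rw [mem_glIntegralLevel_iff', mem_glIntegralLevel_iff']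
  simp only [mem_integralFiniteAdeles_iff, ← smul_inv', GeneralLinearGroup.coe_smul_apply,
    AdeleRing.smul_snd, AdeleRing.smul_fst]
  refine and_congr (and_congr ?_ ?_) ?_
  · constructor
    · intro h i j w
      have := h i j (σ • w)
      rwa [FiniteAdeleRing.smul_apply_smul, galAdicCompletionMap_mem_adicCompletionIntegers_iff] at this
    · intro h i j w
      rw [FiniteAdeleRing.smul_apply, galAdicCompletionMap_mem_adicCompletionIntegers_iff]
      exact h i j _
  · constructor
    · intro h i j w
      have := h i j (σ • w)
      rwa [FiniteAdeleRing.smul_apply_smul, galAdicCompletionMap_mem_adicCompletionIntegers_iff] at this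
    · intro h i j w
      rw [FiniteAdeleRing.smul_apply, galAdicCompletionMap_mem_adicCompletionIntegers_iff]
      exact h i j _
  · have hone : ∀ (τ : E ≃ₐ[F] E) (i j : Fin n),
        τ • (1 : Matrix (Fin n) (Fin n) (InfiniteAdeleRing E)) i j =
          (1 : Matrix (Fin n) (Fin n) (InfiniteAdeleRing E)) i j := by
      intro τ i j
      by_cases hij : i = j
      · subst hij; rw [Matrix.one_apply_eq]; exact smul_one τ
      · rw [Matrix.one_apply_ne hij]; exact smul_zero τ
    constructor
    · intro h i j
      have := congrArg (fun y : InfiniteAdeleRing E => σ⁻¹ • y) (h i j)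
      simp only [inv_smul_smul] at this
      rw [this, hone]
    · intro h i j
      rw [h i j, hone]

/-- The radius `|𝔫|_w` is Galois-invariant: `|σ 𝔫|_{σ w} = |𝔫|_w`. [folklore] -/
theorem idealRadius_smul (σ : E ≃ₐ[F] E) (w : HeightOneSpectrum (𝓞 E)) (𝔫 : Ideal (𝓞 E)) :
    idealRadius E (σ • w) (σ • 𝔫) = idealRadius E w 𝔫 := by
  classical
  rcases eq_or_ne 𝔫 ⊥ with rfl | h𝔫
  · rw [Ideal.smul_bot, idealRadius, idealRadius, FractionalIdeal.coeIdeal_bot, FractionalIdeal.count_zero,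
      FractionalIdeal.count_zero]
  · have hσ𝔫 : σ • 𝔫 ≠ ⊥ := fun h => h𝔫 ((Ideal.smul_eq_bot_iff σ 𝔫).mp h)
    rw [idealRadius, idealRadius, FractionalIdeal.count_coe E _ hσ𝔫, FractionalIdeal.count_coe E _ h𝔫,
      HeightOneSpectrum.count_smul_asIdeal σ w h𝔫]

/-- **`σ` on principal congruence subgroups**: `σ • g ∈ K(σ 𝔫) ↔ g ∈ K(𝔫)`; in particular
`K(𝔫)` is `σ`-stable for `σ`-stable `𝔫` (e.g. `𝔫` extended from `𝓞 F`). [folklore] -/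
theorem GLn.smul_mem_principalCongruenceLevel_iff (σ : E ≃ₐ[F] E) (𝔫 : Ideal (𝓞 E))
    (g : GL (Fin n) (AdeleRing (𝓞 E) E)) :
    σ • g ∈ principalCongruenceLevel n E (σ • 𝔫) ↔ g ∈ principalCongruenceLevel n E 𝔫 := by
  rw [mem_principalCongruenceLevel_iff, mem_principalCongruenceLevel_iff,
    GLn.smul_mem_glIntegralLevel_iff]
  refine and_congr Iff.rfl ⟨fun h w => ?_, fun h w => ?_⟩
  · have := h (σ • w)
    rw [GLn.toLocal_smul_smul, idealRadius_smul] at this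
    exact (GLn.map_galAdicCompletionMap_mem_valuedCongruenceSubgroup_iff F σ rfl _ _).mp this
  · have := (GLn.map_galAdicCompletionMap_mem_valuedCongruenceSubgroup_iff F σ (smul_inv_smul σ w)
      (idealRadius E w (σ • 𝔫)) ((gl n E).toLocal (σ⁻¹ • w) g)).mpr ?_
    · rw [GLn.toLocal_smul]; exact this
    · have hr : idealRadius E w (σ • 𝔫) = idealRadius E (σ⁻¹ • w) 𝔫 := by
        rw [← idealRadius_smul F σ (σ⁻¹ • w) 𝔫, smul_inv_smul]
      rw [hr]; exact h _

/-- For a `σ`-stable level `𝔫`, `K(𝔫)` is `σ`-stable. [folklore] -/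
theorem GLn.smul_mem_principalCongruenceLevel_iff_of_smul_eq (σ : E ≃ₐ[F] E) {𝔫 : Ideal (𝓞 E)}
    (h𝔫 : σ • 𝔫 = 𝔫) (g : GL (Fin n) (AdeleRing (𝓞 E) E)) :
    σ • g ∈ principalCongruenceLevel n E 𝔫 ↔ g ∈ principalCongruenceLevel n E 𝔫 := by
  conv_lhs => rw [← h𝔫]
  exact GLn.smul_mem_principalCongruenceLevel_iff F σ 𝔫 g

omit [NumberField E] in
/-- Ideals extended from `𝓞 F` are `Aut(E/F)`-stable. [folklore] -/
theorem Ideal.smul_map_algebraMap (σ : E ≃ₐ[F] E) (𝔪 : Ideal (𝓞 F)) :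
    σ • (𝔪.map (algebraMap (𝓞 F) (𝓞 E))) = 𝔪.map (algebraMap (𝓞 F) (𝓞 E)) := by
  rw [Ideal.pointwise_smul_def, Ideal.map_map]
  congr 1
  exact RingHom.ext fun x => smul_algebraMap σ x

/-- **`σ` on the Hecke elements**: `σ • t_{w,i}(ϖ) = t_{σ w,i}(σ_w ϖ)`. [folklore] -/
theorem GLn.smul_heckeDiagAt (σ : E ≃ₐ[F] E) (w : HeightOneSpectrum (𝓞 E)) (ϖ : (w.adicCompletion E)ˣ)
    (i : ℕ) :
    σ • heckeDiagAt n E w ϖ i = heckeDiagAt n E (σ • w) (galAdicCompletionUnitsEquiv σ rfl ϖ) i := by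
  classical
  refine Matrix.GeneralLinearGroup.ext fun k l => ?_
  rw [GeneralLinearGroup.coe_smul_apply, heckeDiagAt, heckeDiagAt, coe_glDiagonal, coe_glDiagonal]
  by_cases hkl : k = l
  · subst hkl
    rw [Matrix.diagonal_apply_eq, Matrix.diagonal_apply_eq]
    split_ifs with hk
    · refine Prod.ext ?_ ?_
      · rw [AdeleRing.smul_fst]
        exact smul_one σ
      · rw [AdeleRing.smul_snd]
        change σ • (uniformizerIdele E w ϖ : FiniteAdeleRing (𝓞 E) E) =
          (uniformizerIdele E (σ • w) _ : FiniteAdeleRing (𝓞 E) E)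
        have h1 : (uniformizerIdele E w ϖ : FiniteAdeleRing (𝓞 E) E) =
            FiniteAdeleRing.mulSingle w (ϖ : w.adicCompletion E) := rfl
        have h2 : (uniformizerIdele E (σ • w) (galAdicCompletionUnitsEquiv σ rfl ϖ) :
            FiniteAdeleRing (𝓞 E) E) =
            FiniteAdeleRing.mulSingle (σ • w) (galAdicCompletionMap σ rfl (ϖ : w.adicCompletion E)) :=
          rfl
        rw [h1, h2, FiniteAdeleRing.smul_mulSingle]
    · rw [Units.val_one, smul_one]
  · rw [Matrix.diagonal_apply_ne _ hkl, Matrix.diagonal_apply_ne _ hkl, smul_zero]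

end GLnAdelic

/-! ## Galois conjugation on the automorphic quotient, on `L²`, and on automorphic representations -/

section AutomorphicQuotient

open NumberField AdelicGroupData MeasureTheory

variable (F : Type*) [Field F] {E : Type} [Field E] [NumberField E] [Algebra F E] {n : ℕ}

/-- `σ • ·` respects left cosets of `A_G GL_n(E)`. [folklore] -/
theorem GLn.leftRel_smul (σ : E ≃ₐ[F] E) (a b : (gl n E).Adelic)
    (h : QuotientGroup.leftRel (gl n E).quotientSubgroup a b) :
    QuotientGroup.leftRel (gl n E).quotientSubgroup (σ • a) (σ • b) := by
  rw [QuotientGroup.leftRel_apply] at h ⊢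
  rw [← smul_inv', ← smul_mul']
  exact GLn.smul_mem_quotientSubgroup F σ h

variable {F} in
/-- **The action of `σ ∈ Aut(E/F)` on the automorphic quotient** `GL_n(𝔸_E) ⧸ A_G GL_n(E)`:
`σ • [g] = [σ • g]` (well defined since `σ` preserves `A_G GL_n(E)`). Arthur–Clozel, Ch. 3 §1
(the automorphism `σ` of `G(𝔸_E)` and of `G(E)\G(𝔸_E)`). [folklore] -/
def galQuot (σ : E ≃ₐ[F] E) : (gl n E).automorphicQuotient → (gl n E).automorphicQuotient :=
  Quotient.map' (fun g : (gl n E).Adelic => σ • g) (GLn.leftRel_smul F σ)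

/-- `galQuot σ [g] = [σ • g]` (definitional). [folklore] -/
@[simp] theorem galQuot_toAutomorphicQuotient (σ : E ≃ₐ[F] E) (g : (gl n E).Adelic) :
    galQuot σ ((gl n E).toAutomorphicQuotient g) = (gl n E).toAutomorphicQuotient (σ • g) := rfl

/-- **`Aut(E/F)` acts on the automorphic quotient** of `GL_n` over `E`. A new instance. [folklore] -/
instance instMulActionGalAutomorphicQuotient : MulAction (E ≃ₐ[F] E) (gl n E).automorphicQuotient where
  smul σ x := galQuot σ x
  one_smul x := Quotient.inductionOn' x fun g => congrArg (gl n E).toAutomorphicQuotient (one_smul _ g)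
  mul_smul σ τ x := Quotient.inductionOn' x fun g =>
    congrArg (gl n E).toAutomorphicQuotient (mul_smul σ τ g)

/-- `σ • [g] = [σ • g]` (definitional). [folklore] -/
@[simp] theorem gal_smul_toAutomorphicQuotient (σ : E ≃ₐ[F] E) (g : (gl n E).Adelic) :
    σ • (gl n E).toAutomorphicQuotient g = (gl n E).toAutomorphicQuotient (σ • g) := rfl

/-- **Compatibility of the two actions**: `σ • (g • x) = (σ • g) • (σ • x)` on the automorphic
quotient. [folklore] -/
theorem gal_smul_smul (σ : E ≃ₐ[F] E) (g : (gl n E).Adelic) (x : (gl n E).automorphicQuotient) :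
    σ • (g • x) = (σ • g) • (σ • x) := by
  induction x using Quotient.inductionOn' with
  | h y =>
    change σ • (g • (gl n E).toAutomorphicQuotient y) = (σ • g) • σ • (gl n E).toAutomorphicQuotient y
    rw [AdelicGroupData.smul_toAutomorphicQuotient, gal_smul_toAutomorphicQuotient,
      gal_smul_toAutomorphicQuotient, AdelicGroupData.smul_toAutomorphicQuotient, smul_mul']

/-- `σ⁻¹ • (g • x) = (σ⁻¹ • g) • (σ⁻¹ • x)`, rearranged: `σ • ((σ⁻¹ • g) • x) = g • σ • x`. [folklore] -/
theorem gal_smul_inv_smul_smul (σ : E ≃ₐ[F] E) (g : (gl n E).Adelic)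
    (x : (gl n E).automorphicQuotient) : σ • ((σ⁻¹ • g) • x) = g • (σ • x) := by
  rw [gal_smul_smul, smul_inv_smul]

/-- Each `σ` acts continuously on the automorphic quotient. [folklore] -/
theorem continuous_gal_smul (σ : E ≃ₐ[F] E) :
    Continuous (fun x : (gl n E).automorphicQuotient => σ • x) :=
  (GeneralLinearGroup.continuous_smul (R := AdeleRing (𝓞 E) E) (m := Fin n) σ).quotient_map'
    (GLn.leftRel_smul F σ)

/-- `Aut(E/F)` acts on the automorphic quotient by homeomorphisms. [folklore] -/
instance instContinuousConstSMulGalAutomorphicQuotient :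
    ContinuousConstSMul (E ≃ₐ[F] E) (gl n E).automorphicQuotient :=
  ⟨continuous_gal_smul F⟩

/-- Each `σ` acts measurably (Borel σ-algebra). [folklore] -/
theorem measurable_gal_smul (σ : E ≃ₐ[F] E) :
    Measurable (fun x : (gl n E).automorphicQuotient => σ • x) :=
  (continuous_gal_smul F σ).measurable

/-! ### Automorphic measures under `σ` -/

/-- **The push-forward of an automorphic measure under `σ` is an automorphic measure**
(finite, positive on opens, inner regular, and `GL_n(𝔸_E)`-invariant since
`σ⁻¹(g • s) = (σ⁻¹ g) • σ⁻¹ s`). [folklore] -/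
theorem isAutomorphicMeasure_map_gal_smul (σ : E ≃ₐ[F] E) (ν : Measure (gl n E).automorphicQuotient)
    [(gl n E).IsAutomorphicMeasure ν] :
    (gl n E).IsAutomorphicMeasure (ν.map fun x => σ • x) where
  toIsFiniteMeasure := Measure.isFiniteMeasure_map ν _
  toIsOpenPosMeasure := (continuous_gal_smul F σ).isOpenPosMeasure_map
    (MulAction.surjective σ)
  toInnerRegularCompactLTTop := Measure.InnerRegularCompactLTTop.map_of_continuous (continuous_gal_smul F σ)
  toSMulInvariantMeasure := ⟨fun g s hs => by
    rw [Measure.map_apply (measurable_gal_smul F σ) hs,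
      Measure.map_apply (measurable_gal_smul F σ) (measurableSet_preimage (measurable_const_smul g) hs)]
    have : (fun x : (gl n E).automorphicQuotient => σ • x) ⁻¹' ((fun x => g • x) ⁻¹' s) =
        (fun x => (σ⁻¹ • g) • x) ⁻¹' ((fun x : (gl n E).automorphicQuotient => σ • x) ⁻¹' s) := by
      ext x
      simp only [Set.mem_preimage, gal_smul_inv_smul_smul]
    rw [this, SMulInvariantMeasure.measure_preimage_smul _ ((measurable_gal_smul F σ) hs)]⟩

/-- The automorphic measure `ν` is **`Aut(E/F)`-invariant**: each `σ` is measure preserving.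
By uniqueness of automorphic measures up to scalar and equality of total masses this holds
for every automorphic measure (`isGalInvariant_of_unique`); it is the hypothesis under which
`σ` acts unitarily on `L²(ν)`. [folklore] -/
def IsGalInvariant (ν : Measure (gl n E).automorphicQuotient) : Prop :=
  ∀ σ : E ≃ₐ[F] E, MeasurePreserving (fun x : (gl n E).automorphicQuotient => σ • x) ν ν

/-- **Automorphic measures are `Aut(E/F)`-invariant**, granted uniqueness of automorphic
measures up to a scalar (the named fact `isAutomorphicMeasure_unique_smul` of
`AdelicGroupData`): `σ_* ν` is automorphic, hence `c • ν`, and `σ_* ν (X) = ν (X)` with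
`0 < ν(X) < ∞` forces `c = 1`. [folklore] -/
theorem isGalInvariant_of_unique (hU : isAutomorphicMeasure_unique_smul n E)
    (ν : Measure (gl n E).automorphicQuotient) [(gl n E).IsAutomorphicMeasure ν] :
    IsGalInvariant F ν := by
  intro σ
  haveI := isAutomorphicMeasure_map_gal_smul F σ ν
  obtain ⟨c, hc, hcν⟩ := hU (ν.map fun x => σ • x) ν
  refine ⟨measurable_gal_smul F σ, ?_⟩
  have huniv : (ν.map fun x => σ • x) Set.univ = ν Set.univ := by
    rw [Measure.map_apply (measurable_gal_smul F σ) MeasurableSet.univ, Set.preimage_univ]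
  have hne : ν Set.univ ≠ 0 := IsOpen.measure_ne_zero ν isOpen_univ ⟨σ • (gl n E).toAutomorphicQuotient 1, trivial⟩
  have hc1 : c = 1 := by
    rw [hcν, Measure.smul_apply, ENNReal.smul_def, smul_eq_mul] at huniv
    have h : (c : ENNReal) = 1 := by
      rw [← ENNReal.mul_left_inj hne (measure_ne_top ν _), one_mul]; exact huniv
    exact_mod_cast h
  rw [hc1, one_smul] at hcν
  exact hcν

end AutomorphicQuotient

end Literature.NumberTheory.Automorphic

/-! ## Closed subrepresentations under conjugate-equivariant isomorphisms (generic) -/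

namespace ContRepresentation.ClosedSubrep

section MapConj

variable {k G V V' : Type*} [CommRing k] [Group G]
  [AddCommGroup V] [TopologicalSpace V] [IsTopologicalAddGroup V] [Module k V]
  [AddCommGroup V'] [TopologicalSpace V'] [IsTopologicalAddGroup V'] [Module k V']
  {π : ContRepresentation k G V} {π' : ContRepresentation k G V'}

/-- A topological linear isomorphism `e : V ≃L V'` is **`θ`-conjugate equivariant** from `π` to
`π'`, for a group automorphism `θ` of `G`, if `e (π g v) = π' (θ g) (e v)`: an equivalence
`π ∘ θ⁻¹ ≅ π'` (for `θ = 1`, an equivalence of representations). The case in point: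
`e = ` composition with `σ⁻¹` on `L²` of the automorphic quotient and `θ = σ` entrywise on
`GL_n(𝔸_E)`. [folklore] -/
def IsConjEquivariant (π : ContRepresentation k G V) (π' : ContRepresentation k G V')
    (e : V ≃L[k] V') (θ : G ≃* G) : Prop :=
  ∀ g v, e (π g v) = π' (θ g) (e v)

variable {e : V ≃L[k] V'} {θ : G ≃* G}

/-- The inverse of a `θ`-conjugate equivariant isomorphism is `θ⁻¹`-conjugate equivariant. [folklore] -/
theorem IsConjEquivariant.symm (he : IsConjEquivariant π π' e θ) :
    IsConjEquivariant π' π e.symm θ.symm := by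
  intro g v'
  apply e.injective
  rw [e.apply_symm_apply, he, e.apply_symm_apply, MulEquiv.apply_symm_apply]

/-- **Transport of closed subrepresentations along a conjugate-equivariant isomorphism**: the
image `e(W)` of a closed `π`-invariant subspace is a closed `π'`-invariant subspace
(`π'(g) e(w) = e(π(θ⁻¹ g) w)`). [folklore] -/
def mapConj (W : ClosedSubrep π) (he : IsConjEquivariant π π' e θ) : ClosedSubrep π' where
  toSubmodule := W.toSubmodule.map (e : V →ₗ[k] V')
  apply_mem_toSubmodule g := by
    rintro _ ⟨v, hv, rfl⟩
    refine ⟨π (θ.symm g) v, W.apply_mem _ hv, ?_⟩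
    change e (π (θ.symm g) v) = π' g (e v)
    rw [he, MulEquiv.apply_symm_apply]
  isClosed' := by
    change IsClosed ((W.toSubmodule.map (e : V →ₗ[k] V') : Submodule k V') : Set V')
    rw [Submodule.map_coe]
    exact e.isClosed_image.mpr W.isClosed

/-- The submodule underlying `W.mapConj he` is the image `e(W)` (definitional). [folklore] -/
@[simp]
theorem toSubmodule_mapConj (W : ClosedSubrep π) (he : IsConjEquivariant π π' e θ) :
    (W.mapConj he).toSubmodule = W.toSubmodule.map (e : V →ₗ[k] V') := rfl

/-- `v' ∈ e(W) ↔ e⁻¹ v' ∈ W`. [folklore] -/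
theorem mem_mapConj_iff (W : ClosedSubrep π) (he : IsConjEquivariant π π' e θ) {v' : V'} :
    v' ∈ W.mapConj he ↔ e.symm v' ∈ W := by
  change v' ∈ W.toSubmodule.map (e : V →ₗ[k] V') ↔ _
  constructor
  · rintro ⟨v, hv, rfl⟩
    change e.symm (e v) ∈ W
    rwa [e.symm_apply_apply]
  · intro h
    exact ⟨e.symm v', h, e.apply_symm_apply v'⟩

/-- `e w ∈ e(W)` for `w ∈ W`. [folklore] -/
theorem apply_mem_mapConj (W : ClosedSubrep π) (he : IsConjEquivariant π π' e θ) {v : V}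
    (hv : v ∈ W) : e v ∈ W.mapConj he :=
  (W.mem_mapConj_iff he).mpr (by rwa [e.symm_apply_apply])

/-- `e w ∈ e(W) ↔ w ∈ W`. [folklore] -/
theorem apply_mem_mapConj_iff (W : ClosedSubrep π) (he : IsConjEquivariant π π' e θ) {v : V} :
    e v ∈ W.mapConj he ↔ v ∈ W := by
  rw [mem_mapConj_iff, e.symm_apply_apply]

/-- `e⁻¹(e(W)) = W`. [folklore] -/
theorem mapConj_mapConj_symm (W : ClosedSubrep π) (he : IsConjEquivariant π π' e θ) :
    (W.mapConj he).mapConj he.symm = W := by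
  ext v
  rw [mem_mapConj_iff, mem_mapConj_iff, e.symm_symm, e.symm_apply_apply]

/-- `e(e⁻¹(W')) = W'`. [folklore] -/
theorem mapConj_symm_mapConj (W' : ClosedSubrep π') (he : IsConjEquivariant π π' e θ) :
    (W'.mapConj he.symm).mapConj he = W' := by
  ext v
  rw [mem_mapConj_iff, mem_mapConj_iff, e.symm_symm, e.apply_symm_apply]

/-- `e(W₁) ≤ e(W₂) ↔ W₁ ≤ W₂`. [folklore] -/
theorem mapConj_le_mapConj_iff {W₁ W₂ : ClosedSubrep π} (he : IsConjEquivariant π π' e θ) :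
    W₁.mapConj he ≤ W₂.mapConj he ↔ W₁ ≤ W₂ := by
  constructor
  · intro h v hv
    have := h (W₁.apply_mem_mapConj he hv)
    rwa [apply_mem_mapConj_iff] at this
  · intro h v' hv'
    rw [mem_mapConj_iff] at hv' ⊢
    exact h hv'

/-- `e(W₁) = e(W₂) ↔ W₁ = W₂`. [folklore] -/
theorem mapConj_inj {W₁ W₂ : ClosedSubrep π} (he : IsConjEquivariant π π' e θ) :
    W₁.mapConj he = W₂.mapConj he ↔ W₁ = W₂ := by
  simp only [le_antisymm_iff, mapConj_le_mapConj_iff he]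

/-- Transport along a conjugate-equivariant isomorphism is an **order isomorphism** between the
lattices of closed subrepresentations. [folklore] -/
def mapConjOrderIso (he : IsConjEquivariant π π' e θ) : ClosedSubrep π ≃o ClosedSubrep π' where
  toFun W := W.mapConj he
  invFun W' := W'.mapConj he.symm
  left_inv W := W.mapConj_mapConj_symm he
  right_inv W' := W'.mapConj_symm_mapConj he
  map_rel_iff' := mapConj_le_mapConj_iff he

/-- **Topological irreducibility is invariant under conjugate-equivariant isomorphisms.** [folklore] -/
theorem isTopIrreducible_iff_of_isConjEquivariant [T1Space V] [T1Space V']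
    (he : IsConjEquivariant π π' e θ) : π.IsTopIrreducible ↔ π'.IsTopIrreducible :=
  (mapConjOrderIso he).isSimpleOrder_iff

/-- The isomorphism `W ≃L e(W)` induced by `e`. [folklore] -/
def mapConjEquiv (W : ClosedSubrep π) (he : IsConjEquivariant π π' e θ) :
    W.toSubmodule ≃L[k] (W.mapConj he).toSubmodule where
  toLinearEquiv :=
    { toFun := fun w => ⟨e (w : V), W.apply_mem_mapConj he w.2⟩
      map_add' := fun w w' => Subtype.ext (map_add e (w : V) (w' : V))
      map_smul' := fun c w => Subtype.ext (map_smul e c (w : V))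
      invFun := fun w' => ⟨e.symm (w' : V'), (W.mem_mapConj_iff he).mp w'.2⟩
      left_inv := fun w => Subtype.ext (e.symm_apply_apply w)
      right_inv := fun w' => Subtype.ext (e.apply_symm_apply w') }
  continuous_toFun := (e.continuous.comp continuous_subtype_val).subtype_mk _
  continuous_invFun := (e.symm.continuous.comp continuous_subtype_val).subtype_mk _

/-- `mapConjEquiv w = e w` in `V'`. [folklore] -/
@[simp]
theorem coe_mapConjEquiv_apply (W : ClosedSubrep π) (he : IsConjEquivariant π π' e θ)
    (w : W.toSubmodule) : (W.mapConjEquiv he w : V') = e w := rfl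

/-- `mapConjEquiv` is `θ`-conjugate equivariant between the representations on `W` and on
`e(W)`. [folklore] -/
theorem isConjEquivariant_mapConjEquiv (W : ClosedSubrep π) (he : IsConjEquivariant π π' e θ) :
    IsConjEquivariant W.toContRep (W.mapConj he).toContRep (W.mapConjEquiv he) θ :=
  fun g w => Subtype.ext (he g w)

/-- **`e(W)` is irreducible iff `W` is.** [folklore] -/
theorem isTopIrreducible_mapConj_iff [T1Space V] [T1Space V'] (W : ClosedSubrep π)
    (he : IsConjEquivariant π π' e θ) :
    (W.mapConj he).toContRep.IsTopIrreducible ↔ W.toContRep.IsTopIrreducible :=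
  (isTopIrreducible_iff_of_isConjEquivariant (W.isConjEquivariant_mapConjEquiv he)).symm

/-- Fixed vectors correspond: `e w` is `θ(Kf)`-fixed iff `w` is `Kf`-fixed. [folklore] -/
theorem mapConjEquiv_mem_fixedVectors_iff (W : ClosedSubrep π) (he : IsConjEquivariant π π' e θ)
    (Kf : Subgroup G) (w : W.toSubmodule) :
    W.mapConjEquiv he w ∈ (W.mapConj he).fixedVectors (Kf.map θ.toMonoidHom) ↔
      w ∈ W.fixedVectors Kf := by
  rw [mem_fixedVectors, mem_fixedVectors]
  constructor
  · intro h x hx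
    have := h (θ x) ⟨x, hx, rfl⟩
    rw [← W.isConjEquivariant_mapConjEquiv he x w] at this
    exact (W.mapConjEquiv he).injective this
  · rintro h _ ⟨x, hx, rfl⟩
    change (W.mapConj he).toContRep (θ x) (W.mapConjEquiv he w) = _
    rw [← W.isConjEquivariant_mapConjEquiv he x w, h x hx]

end MapConj

end ContRepresentation.ClosedSubrep

namespace Literature.NumberTheory.Automorphic

/-! ## `σ` on `L²` of the automorphic quotient and on automorphic representations of `GL_n(𝔸_E)` -/

section L2

open NumberField AdelicGroupData MeasureTheory

variable (F : Type*) [Field F] {E : Type} [Field E] [NumberField E] [Algebra F E] {n : ℕ}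
variable {ν : Measure (gl n E).automorphicQuotient}

/-- **`σ` acting on `L²(GL_n(𝔸_E) ⧸ A_G GL_n(E), ν)`**: `(U_σ f)(x) = f (σ⁻¹ • x)`, a linear
isometry for a `Gal`-invariant `ν` (Mathlib `Lp.compMeasurePreservingₗᵢ`): the translate of
automorphic forms `φ ↦ φ ∘ σ⁻¹`, a *left* action of `Aut(E/F)` (`U_σ U_τ = U_{σ τ}`). Convention
warning: `U_σ(W)` realises the representation `W ∘ σ⁻¹`, which is `Π^{σ⁻¹}` in Arthur–Clozel's
notation `Π^σ(g) := Π(σ g)` (Ch. 1 §2.1); see `ClosedSubrep.galConj`. [folklore] -/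
def galL2 (hν : IsGalInvariant F ν) (σ : E ≃ₐ[F] E) : (gl n E).L2 ν →ₗᵢ[ℂ] (gl n E).L2 ν :=
  Lp.compMeasurePreservingₗᵢ ℂ (fun x : (gl n E).automorphicQuotient => σ⁻¹ • x) (hν σ⁻¹)

/-- The a.e. formula `(U_σ f)(x) = f (σ⁻¹ • x)`. [folklore] -/
theorem galL2_coeFn (hν : IsGalInvariant F ν) (σ : E ≃ₐ[F] E) (f : (gl n E).L2 ν) :
    (galL2 F hν σ f : (gl n E).automorphicQuotient → ℂ) =ᵐ[ν] fun x => f (σ⁻¹ • x) :=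
  Lp.coeFn_compMeasurePreserving f (hν σ⁻¹)

/-- `galL2` on the class of a function: `U_σ [φ] = [φ ∘ σ⁻¹]`. [folklore] -/
theorem galL2_toLp (hν : IsGalInvariant F ν) (σ : E ≃ₐ[F] E)
    {φ : (gl n E).automorphicQuotient → ℂ} (hφ : MemLp φ 2 ν) :
    galL2 F hν σ (hφ.toLp φ) = (hφ.comp_measurePreserving (hν σ⁻¹)).toLp (fun x => φ (σ⁻¹ • x)) :=
  Lp.toLp_compMeasurePreserving hφ (hν σ⁻¹)

/-- `U_σ` preserves the norm. [folklore] -/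
theorem norm_galL2 (hν : IsGalInvariant F ν) (σ : E ≃ₐ[F] E) (f : (gl n E).L2 ν) :
    ‖galL2 F hν σ f‖ = ‖f‖ :=
  (galL2 F hν σ).norm_map f

/-- `compMeasurePreserving` only depends on the function, not on the proof. [folklore] -/
theorem Lp.compMeasurePreserving_congr_fun {α : Type*} [MeasurableSpace α] {μ : Measure α}
    {f₁ f₂ : α → α} (h : f₁ = f₂) (h₁ : MeasurePreserving f₁ μ μ) (h₂ : MeasurePreserving f₂ μ μ)
    (g : Lp ℂ 2 μ) : Lp.compMeasurePreserving f₁ h₁ g = Lp.compMeasurePreserving f₂ h₂ g := by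
  subst h; rfl

/-- **Cocycle law**: `U_σ (U_τ f) = U_{σ τ} f`. [folklore] -/
theorem galL2_galL2 (hν : IsGalInvariant F ν) (σ τ : E ≃ₐ[F] E) (f : (gl n E).L2 ν) :
    galL2 F hν σ (galL2 F hν τ f) = galL2 F hν (σ * τ) f := by
  change Lp.compMeasurePreserving _ (hν σ⁻¹) (Lp.compMeasurePreserving _ (hν τ⁻¹) f) =
    Lp.compMeasurePreserving _ (hν (σ * τ)⁻¹) f
  rw [← Lp.compMeasurePreserving_comp_apply f (hν τ⁻¹) (hν σ⁻¹)]
  exact Lp.compMeasurePreserving_congr_fun (funext fun x => by simp [mul_smul, mul_inv_rev]) _ _ f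

/-- `U_1 = id`. [folklore] -/
@[simp] theorem galL2_one (hν : IsGalInvariant F ν) (f : (gl n E).L2 ν) : galL2 F hν 1 f = f := by
  change Lp.compMeasurePreserving _ (hν 1⁻¹) f = f
  rw [Lp.compMeasurePreserving_congr_fun (f₂ := id) (funext fun x => by simp) (hν 1⁻¹)
    (MeasurePreserving.id ν) f, Lp.compMeasurePreserving_id_apply]

/-- `U_{σ⁻¹} (U_σ f) = f`. [folklore] -/
@[simp] theorem galL2_inv_galL2 (hν : IsGalInvariant F ν) (σ : E ≃ₐ[F] E) (f : (gl n E).L2 ν) :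
    galL2 F hν σ⁻¹ (galL2 F hν σ f) = f := by
  rw [galL2_galL2, inv_mul_cancel, galL2_one]

/-- `U_σ (U_{σ⁻¹} f) = f`. [folklore] -/
@[simp] theorem galL2_galL2_inv (hν : IsGalInvariant F ν) (σ : E ≃ₐ[F] E) (f : (gl n E).L2 ν) :
    galL2 F hν σ (galL2 F hν σ⁻¹ f) = f := by
  rw [galL2_galL2, mul_inv_cancel, galL2_one]

/-- `U_σ` as a linear isometric *equivalence* of `L²(ν)` (inverse `U_{σ⁻¹}`). [folklore] -/
def galL2Equiv (hν : IsGalInvariant F ν) (σ : E ≃ₐ[F] E) : (gl n E).L2 ν ≃ₗᵢ[ℂ] (gl n E).L2 ν where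
  toLinearEquiv :=
    { (galL2 F hν σ).toLinearMap with
      invFun := galL2 F hν σ⁻¹
      left_inv := galL2_inv_galL2 F hν σ
      right_inv := galL2_galL2_inv F hν σ }
  norm_map' := norm_galL2 F hν σ

/-- `galL2Equiv` is `galL2` as a function (definitional). [folklore] -/
@[simp] theorem coe_galL2Equiv (hν : IsGalInvariant F ν) (σ : E ≃ₐ[F] E) :
    ⇑(galL2Equiv F hν σ) = galL2 F hν σ := rfl

/-- The inverse of `galL2Equiv σ` is `galL2 σ⁻¹`. [folklore] -/
@[simp] theorem galL2Equiv_symm_apply (hν : IsGalInvariant F ν) (σ : E ≃ₐ[F] E) (f : (gl n E).L2 ν) :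
    (galL2Equiv F hν σ).symm f = galL2 F hν σ⁻¹ f := rfl

variable [SMulInvariantMeasure (gl n E).Adelic (gl n E).automorphicQuotient ν]

/-- **The intertwining relation** `U_σ R(g) = R(σ • g) U_σ` between `σ` on `L²` and the regular
representation: `σ` conjugates translation by `g` into translation by `σ(g)`; hence on `U_σ(W)`
the element `g` acts as `σ⁻¹ g` acts on `W` (`U_σ(W) ≅ W ∘ σ⁻¹`, Arthur–Clozel's `Π^{σ⁻¹}`,
their `Π^σ` being `Π ∘ σ`, Ch. 1 §2.1). [folklore] -/
theorem galL2_rightRegular (hν : IsGalInvariant F ν) (σ : E ≃ₐ[F] E) (g : (gl n E).Adelic)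
    (f : (gl n E).L2 ν) :
    galL2 F hν σ ((gl n E).rightRegular ν g f) = (gl n E).rightRegular ν (σ • g) (galL2 F hν σ f) := by
  apply Lp.ext
  have h1 := galL2_coeFn F hν σ ((gl n E).rightRegular ν g f)
  have h2 : (fun x => ((gl n E).rightRegular ν g f : (gl n E).automorphicQuotient → ℂ) (σ⁻¹ • x)) =ᵐ[ν]
      fun x => f (g⁻¹ • σ⁻¹ • x) := by
    have h0 : ((gl n E).rightRegular ν g f : (gl n E).automorphicQuotient → ℂ)
        =ᵐ[ν.map fun x : (gl n E).automorphicQuotient => σ⁻¹ • x] fun y => f (g⁻¹ • y) := by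
      rw [(hν σ⁻¹).map_eq]; exact (gl n E).rightRegular_apply_coeFn ν g f
    exact ae_eq_comp (hν σ⁻¹).measurable.aemeasurable h0
  have h3 := (gl n E).rightRegular_apply_coeFn ν (σ • g) (galL2 F hν σ f)
  have h4 : (fun x => (galL2 F hν σ f : (gl n E).automorphicQuotient → ℂ) ((σ • g)⁻¹ • x)) =ᵐ[ν]
      fun x => f (σ⁻¹ • (σ • g)⁻¹ • x) := by
    have h0 : (galL2 F hν σ f : (gl n E).automorphicQuotient → ℂ)
        =ᵐ[ν.map fun x : (gl n E).automorphicQuotient => (σ • g)⁻¹ • x] fun y => f (σ⁻¹ • y) := by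
      rw [(measurePreserving_smul ((σ • g)⁻¹) ν).map_eq]; exact galL2_coeFn F hν σ f
    exact ae_eq_comp (measurable_const_smul ((σ • g)⁻¹)).aemeasurable h0
  have h5 : (fun x => (f : (gl n E).automorphicQuotient → ℂ) (g⁻¹ • σ⁻¹ • x)) =
      fun x => f (σ⁻¹ • (σ • g)⁻¹ • x) := by
    funext x
    rw [gal_smul_smul, ← smul_inv', inv_smul_smul]
  exact h1.trans (h2.trans ((Filter.EventuallyEq.of_eq h5).trans (h3.trans h4).symm))

/-- `U_σ` is `σ`-conjugate equivariant for the regular representation (`IsConjEquivariant` with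
`θ = σ` acting entrywise on `GL_n(𝔸_E)`). [folklore] -/
theorem isConjEquivariant_galL2Equiv (hν : IsGalInvariant F ν) (σ : E ≃ₐ[F] E) :
    ContRepresentation.ClosedSubrep.IsConjEquivariant ((gl n E).rightRegular ν) ((gl n E).rightRegular ν)
      (galL2Equiv F hν σ : (gl n E).L2 ν ≃L[ℂ] (gl n E).L2 ν)
      (MulDistribMulAction.toMulEquiv (gl n E).Adelic σ) :=
  fun g f => galL2_rightRegular F hν σ g f

variable {F} in
/-- **The Galois conjugate `U_σ(W)` of a closed subrepresentation** `W ≤ L²(ν)` of the regular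
representation of `GL_n(𝔸_E)` (written `W^σ` in this file): the image of `W` under the unitary
`U_σ : f ↦ f ∘ σ⁻¹`, again a closed subrepresentation, on which `R(g)` acts as `R(σ⁻¹ g)` acts on
`W`. As an abstract representation `U_σ(W) ≅ W ∘ σ⁻¹`; in Arthur–Clozel's notation
`Π^σ(g) := Π(σ g)` (Ch. 1, §2.1, where "`Π` is `σ`-stable if it is equivalent to `Π^σ`") this is
`Π^{σ⁻¹}`, so `σ ↦ U_σ(W)` runs through the same Galois orbit `{Π^σ}` with `σ` relabelled `σ⁻¹`;
the orbit, and stability under all of `Aut(E/F)` (`IsGalStable`), are convention-independent.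
[cite: ArthurClozelAMS120, Ch. 1 §2.1 (`Π^σ`, `σ`-stable)] -/
def _root_.ContRepresentation.ClosedSubrep.galConj
    (W : ContRepresentation.ClosedSubrep ((gl n E).rightRegular ν)) (hν : IsGalInvariant F ν)
    (σ : E ≃ₐ[F] E) : ContRepresentation.ClosedSubrep ((gl n E).rightRegular ν) :=
  W.mapConj (isConjEquivariant_galL2Equiv F hν σ)

/-- Membership in `W^σ`: `f ∈ W^σ ↔ U_{σ⁻¹} f ∈ W`. [folklore] -/
theorem _root_.ContRepresentation.ClosedSubrep.mem_galConj_iff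
    (W : ContRepresentation.ClosedSubrep ((gl n E).rightRegular ν)) (hν : IsGalInvariant F ν)
    (σ : E ≃ₐ[F] E) {f : (gl n E).L2 ν} : f ∈ W.galConj hν σ ↔ galL2 F hν σ⁻¹ f ∈ W :=
  W.mem_mapConj_iff _

/-- `U_σ f ∈ W^σ ↔ f ∈ W`. [folklore] -/
theorem _root_.ContRepresentation.ClosedSubrep.galL2_mem_galConj_iff
    (W : ContRepresentation.ClosedSubrep ((gl n E).rightRegular ν)) (hν : IsGalInvariant F ν)
    (σ : E ≃ₐ[F] E) {f : (gl n E).L2 ν} : galL2 F hν σ f ∈ W.galConj hν σ ↔ f ∈ W :=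
  W.apply_mem_mapConj_iff _

/-- `W^1 = W`. [folklore] -/
@[simp] theorem _root_.ContRepresentation.ClosedSubrep.galConj_one
    (W : ContRepresentation.ClosedSubrep ((gl n E).rightRegular ν)) (hν : IsGalInvariant F ν) :
    W.galConj hν 1 = W := by
  ext f
  rw [ContRepresentation.ClosedSubrep.mem_galConj_iff, inv_one, galL2_one]

/-- `(W^τ)^σ = W^{σ τ}`. [folklore] -/
theorem _root_.ContRepresentation.ClosedSubrep.galConj_galConj
    (W : ContRepresentation.ClosedSubrep ((gl n E).rightRegular ν)) (hν : IsGalInvariant F ν)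
    (σ τ : E ≃ₐ[F] E) : (W.galConj hν τ).galConj hν σ = W.galConj hν (σ * τ) := by
  ext f
  rw [ContRepresentation.ClosedSubrep.mem_galConj_iff, ContRepresentation.ClosedSubrep.mem_galConj_iff,
    ContRepresentation.ClosedSubrep.mem_galConj_iff, galL2_galL2, mul_inv_rev]

/-- `(W^σ)^{σ⁻¹} = W`. [folklore] -/
@[simp] theorem _root_.ContRepresentation.ClosedSubrep.galConj_inv_galConj
    (W : ContRepresentation.ClosedSubrep ((gl n E).rightRegular ν)) (hν : IsGalInvariant F ν)
    (σ : E ≃ₐ[F] E) : (W.galConj hν σ).galConj hν σ⁻¹ = W := by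
  rw [ContRepresentation.ClosedSubrep.galConj_galConj, inv_mul_cancel,
    ContRepresentation.ClosedSubrep.galConj_one]

/-- `W ↦ W^σ` is injective. [folklore] -/
theorem _root_.ContRepresentation.ClosedSubrep.galConj_inj
    {W W' : ContRepresentation.ClosedSubrep ((gl n E).rightRegular ν)} (hν : IsGalInvariant F ν)
    (σ : E ≃ₐ[F] E) : W.galConj hν σ = W'.galConj hν σ ↔ W = W' :=
  ContRepresentation.ClosedSubrep.mapConj_inj _

/-- **`W^σ` is irreducible iff `W` is.** [folklore] -/
theorem _root_.ContRepresentation.ClosedSubrep.isTopIrreducible_galConj_iff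
    (W : ContRepresentation.ClosedSubrep ((gl n E).rightRegular ν)) (hν : IsGalInvariant F ν)
    (σ : E ≃ₐ[F] E) : (W.galConj hν σ).toContRep.IsTopIrreducible ↔ W.toContRep.IsTopIrreducible :=
  W.isTopIrreducible_mapConj_iff _

end L2

/-! ### Cusp forms under `σ` -/

section CuspForms

open NumberField AdelicGroupData MeasureTheory

variable (F : Type*) [Field F] {E : Type} [Field E] [NumberField E] [Algebra F E] {n : ℕ}

/-- `σ` acting entrywise on the block-nilpotent matrices `𝔫_k(𝔸_E)` (it preserves the block
shape), as an additive automorphism. [folklore] -/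
def galBlock (k : ℕ) (σ : E ≃ₐ[F] E) :
    blockNilpotent n k (AdeleRing (𝓞 E) E) ≃+ blockNilpotent n k (AdeleRing (𝓞 E) E) where
  toFun X := ⟨(X : Matrix (Fin n) (Fin n) (AdeleRing (𝓞 E) E)).map (σ • ·), fun i j h =>
    X.2 i j fun h0 => h (by rw [Matrix.map_apply, h0]; exact smul_zero σ)⟩
  invFun X := ⟨(X : Matrix (Fin n) (Fin n) (AdeleRing (𝓞 E) E)).map (σ⁻¹ • ·), fun i j h =>
    X.2 i j fun h0 => h (by rw [Matrix.map_apply, h0]; exact smul_zero σ⁻¹)⟩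
  left_inv X := Subtype.ext (Matrix.ext fun i j => inv_smul_smul σ _)
  right_inv X := Subtype.ext (Matrix.ext fun i j => smul_inv_smul σ _)
  map_add' X Y := Subtype.ext (Matrix.ext fun i j => smul_add σ _ _)

/-- Entries of `galBlock k σ X`. [folklore] -/
@[simp] theorem coe_galBlock_apply (k : ℕ) (σ : E ≃ₐ[F] E)
    (X : blockNilpotent n k (AdeleRing (𝓞 E) E)) (i j : Fin n) :
    ((galBlock F k σ X : blockNilpotent n k (AdeleRing (𝓞 E) E)) :
      Matrix (Fin n) (Fin n) (AdeleRing (𝓞 E) E)) i j =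
      σ • (X : Matrix (Fin n) (Fin n) (AdeleRing (𝓞 E) E)) i j := rfl

/-- `galBlock k σ` is continuous (entrywise continuity). [folklore] -/
theorem continuous_galBlock (k : ℕ) (σ : E ≃ₐ[F] E) : Continuous (galBlock F (n := n) k σ) :=
  Continuous.subtype_mk ((continuous_subtype_val.matrix_map (AdeleRing.continuous_smul F σ))) _

/-- `galBlock k σ⁻¹` is the inverse of `galBlock k σ`. [folklore] -/
theorem galBlock_symm (k : ℕ) (σ : E ≃ₐ[F] E) : (galBlock F (n := n) k σ).symm = galBlock F k σ⁻¹ := by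
  ext X : 1
  rfl

/-- `galBlock` as a continuous additive isomorphism. [folklore] -/
def galBlockContinuous (k : ℕ) (σ : E ≃ₐ[F] E) :
    blockNilpotent n k (AdeleRing (𝓞 E) E) ≃ₜ+ blockNilpotent n k (AdeleRing (𝓞 E) E) :=
  { galBlock F k σ with
    continuous_toFun := continuous_galBlock F k σ
    continuous_invFun := by
      change Continuous (galBlock F (n := n) k σ).symm
      rw [galBlock_symm]; exact continuous_galBlock F k σ⁻¹ }

/-- **`σ` on unipotent elements**: `σ • (1 + X) = 1 + σ X`. [folklore] -/
theorem GLn.smul_glUnipotent (k : ℕ) (σ : E ≃ₐ[F] E) (X : blockNilpotent n k (AdeleRing (𝓞 E) E)) :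
    σ • glUnipotent n k E (Multiplicative.ofAdd X) =
      glUnipotent n k E (Multiplicative.ofAdd (galBlock F k σ X)) := by
  refine Matrix.GeneralLinearGroup.ext fun i j => ?_
  change σ • ((unipotentOfBlock n k (AdeleRing (𝓞 E) E) (Multiplicative.ofAdd X) :
    Matrix (Fin n) (Fin n) (AdeleRing (𝓞 E) E)) i j) =
    (unipotentOfBlock n k (AdeleRing (𝓞 E) E) (Multiplicative.ofAdd (galBlock F k σ X)) :
      Matrix (Fin n) (Fin n) (AdeleRing (𝓞 E) E)) i j
  rw [coe_unipotentOfBlock, coe_unipotentOfBlock, Matrix.add_apply, Matrix.add_apply, smul_add,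
    toAdd_ofAdd, toAdd_ofAdd, coe_galBlock_apply]
  congr 1
  by_cases hij : i = j
  · subst hij; rw [Matrix.one_apply_eq]; exact smul_one σ
  · rw [Matrix.one_apply_ne hij]; exact smul_zero σ

/-- `σ` preserves the rational block-nilpotent matrices `𝔫_k(E)`. [folklore] -/
theorem galBlock_mem_rationalBlock_iff (k : ℕ) (σ : E ≃ₐ[F] E)
    (X : blockNilpotent n k (AdeleRing (𝓞 E) E)) :
    galBlock F k σ X ∈ rationalBlock n k E ↔ X ∈ rationalBlock n k E := by
  rw [mem_rationalBlock_iff, mem_rationalBlock_iff]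
  constructor
  · intro h i j
    obtain ⟨x, hx⟩ := h i j
    rw [coe_galBlock_apply] at hx
    refine ⟨σ⁻¹ x, ?_⟩
    have hx' : σ⁻¹ • algebraMap E (AdeleRing (𝓞 E) E) x =
        (X : Matrix (Fin n) (Fin n) (AdeleRing (𝓞 E) E)) i j := by
      rw [hx, inv_smul_smul]
    rw [AdeleRing.smul_algebraMap] at hx'
    exact hx'
  · intro h i j
    obtain ⟨x, hx⟩ := h i j
    refine ⟨σ x, ?_⟩
    rw [coe_galBlock_apply, ← hx, AdeleRing.smul_algebraMap]

/-- `galBlock` restricted to `𝔫_k(E)`, as a bijection of the acting lattice. [folklore] -/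
def galRationalBlock (k : ℕ) (σ : E ≃ₐ[F] E) : rationalBlock n k E ≃ rationalBlock n k E where
  toFun γ := ⟨galBlock F k σ γ, (galBlock_mem_rationalBlock_iff F k σ _).mpr γ.2⟩
  invFun γ := ⟨galBlock F k σ⁻¹ γ, (galBlock_mem_rationalBlock_iff F k σ⁻¹ _).mpr γ.2⟩
  left_inv γ := Subtype.ext (Subtype.ext (Matrix.ext fun i j =>
    inv_smul_smul σ (((γ : blockNilpotent n k (AdeleRing (𝓞 E) E)) :
      Matrix (Fin n) (Fin n) (AdeleRing (𝓞 E) E)) i j)))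
  right_inv γ := Subtype.ext (Subtype.ext (Matrix.ext fun i j =>
    smul_inv_smul σ (((γ : blockNilpotent n k (AdeleRing (𝓞 E) E)) :
      Matrix (Fin n) (Fin n) (AdeleRing (𝓞 E) E)) i j)))

/-- **Constant terms of `φ ∘ σ⁻¹`.** If the `k`-th constant terms of `φ` vanish, so do those of
`x ↦ φ (σ • x)`: after `σ • ([x (1 + X)]) = [σx · (1 + σX)]`, the integral over a fundamental
domain `𝓕` of `𝔫_k(E)` becomes, by the change of variables `X ↦ σ X` (which maps Haar measures to
Haar measures and fundamental domains of `𝔫_k(E)` to fundamental domains), an instance of the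
hypothesis at the point `σ x`. [folklore] -/
theorem ConstantTermVanishes.comp_gal_smul {φ : (gl n E).automorphicQuotient → ℂ} {k : ℕ}
    (hφ : ConstantTermVanishes n E φ k) (σ : E ≃ₐ[F] E) :
    ConstantTermVanishes n E (fun x => φ (σ • x)) k := by
  intro ν' _ 𝓕 h𝓕 x
  -- the change of variables `S = galBlock σ`
  set S := galBlockContinuous F (n := n) k σ with hS
  let Sm : blockNilpotent n k (AdeleRing (𝓞 E) E) ≃ᵐ blockNilpotent n k (AdeleRing (𝓞 E) E) :=
    S.toHomeomorph.toMeasurableEquiv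
  have hSm : ∀ X, Sm X = galBlock F k σ X := fun X => rfl
  haveI : (Measure.map Sm ν').IsAddHaarMeasure :=
    AddEquiv.isAddHaarMeasure_map ν' (galBlock F k σ) (continuous_galBlock F k σ)
      (by rw [galBlock_symm]; exact continuous_galBlock F k σ⁻¹)
  have hpres : MeasurePreserving Sm ν' (Measure.map Sm ν') := ⟨Sm.measurable, rfl⟩
  -- `S 𝓕` is a fundamental domain for the push-forward measure
  have h𝓕' : IsAddFundamentalDomain (rationalBlock n k E) (Sm '' 𝓕) (Measure.map Sm ν') := by
    refine h𝓕.image_of_equiv Sm.toEquiv ?_ (galRationalBlock F k σ).symm fun γ X => ?_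
    · change MeasureTheory.Measure.QuasiMeasurePreserving Sm.symm (Measure.map Sm ν') ν'
      refine ⟨Sm.symm.measurable, ?_⟩
      rw [Measure.map_map Sm.symm.measurable Sm.measurable, MeasurableEquiv.symm_comp_self,
        Measure.map_id]
    · change Sm ((galRationalBlock F k σ).symm γ +ᵥ X) = γ +ᵥ Sm X
      rw [hSm, hSm]
      refine Subtype.ext (Matrix.ext fun i j => ?_)
      change σ • ((σ⁻¹ • ((γ : blockNilpotent n k (AdeleRing (𝓞 E) E)) : Matrix (Fin n) (Fin n)
        (AdeleRing (𝓞 E) E)) i j) + (X : Matrix (Fin n) (Fin n) (AdeleRing (𝓞 E) E)) i j) =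
        ((γ : blockNilpotent n k (AdeleRing (𝓞 E) E)) : Matrix (Fin n) (Fin n) (AdeleRing (𝓞 E) E)) i j +
          σ • (X : Matrix (Fin n) (Fin n) (AdeleRing (𝓞 E) E)) i j
      rw [smul_add, smul_inv_smul]
  -- the integrand after `σ`
  have hint : ∀ X : blockNilpotent n k (AdeleRing (𝓞 E) E),
      φ (σ • (gl n E).toAutomorphicQuotient (x * glUnipotent n k E (Multiplicative.ofAdd X))) =
        φ ((gl n E).toAutomorphicQuotient ((σ • x) * glUnipotent n k E (Multiplicative.ofAdd (Sm X)))) := by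
    intro X
    rw [gal_smul_toAutomorphicQuotient, smul_mul', GLn.smul_glUnipotent, hSm]
  obtain ⟨hi, h0⟩ := hφ (Measure.map Sm ν') (Sm '' 𝓕) h𝓕' (σ • x)
  simp_rw [hint]
  refine ⟨?_, ?_⟩
  · have := (hpres.integrableOn_image Sm.measurableEmbedding).mp hi
    exact this
  · have h1 := setIntegral_map_equiv (μ := ν') Sm
      (fun Y => φ ((gl n E).toAutomorphicQuotient ((σ • x) * glUnipotent n k E (Multiplicative.ofAdd Y))))
      (Sm '' 𝓕)
    rw [h0, Sm.preimage_image] at h1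
    exact h1.symm

variable (μ : Measure (gl n E).automorphicQuotient)

/-- **Galois conjugates of continuous cusp forms are continuous cusp forms**: for `φ ∈ cuspForms`
and a `Gal`-invariant `μ`, `x ↦ φ (σ • x)` is in `cuspForms`. [folklore] -/
theorem comp_gal_smul_mem_cuspForms {φ : (gl n E).automorphicQuotient → ℂ}
    (hφ : φ ∈ cuspForms n E μ) (hμ : IsGalInvariant F μ) (σ : E ≃ₐ[F] E) :
    (fun x => φ (σ • x)) ∈ cuspForms n E μ :=
  ⟨hφ.1.comp (continuous_gal_smul F σ), hφ.2.1.comp_measurePreserving (hμ σ),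
    fun k hk hkn => (hφ.2.2 k hk hkn).comp_gal_smul F σ⟩

/-- `U_σ` maps the image of `cuspForms` in `L²` into itself: `U_σ [φ] = [φ ∘ σ⁻¹]`. [folklore] -/
theorem galL2_mem_range_cuspFormsToLp (hμ : IsGalInvariant F μ) (σ : E ≃ₐ[F] E)
    {f : (gl n E).L2 μ} (hf : f ∈ LinearMap.range (cuspFormsToLp n E μ)) :
    galL2 F hμ σ f ∈ LinearMap.range (cuspFormsToLp n E μ) := by
  obtain ⟨φ, rfl⟩ := hf
  refine ⟨⟨fun x => (φ : (gl n E).automorphicQuotient → ℂ) (σ⁻¹ • x),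
    comp_gal_smul_mem_cuspForms F μ φ.2 hμ σ⁻¹⟩, ?_⟩
  rw [cuspFormsToLp_apply, cuspFormsToLp_apply, galL2_toLp]

variable [SMulInvariantMeasure (gl n E).Adelic (gl n E).automorphicQuotient μ]

/-- **`U_σ` preserves the cuspidal subspace** `L²_cusp` (it preserves the image of the
continuous cusp forms and is continuous). [folklore] -/
theorem galL2_mem_cuspidalSubspace (hμ : IsGalInvariant F μ) (σ : E ≃ₐ[F] E) {f : (gl n E).L2 μ}
    (hf : f ∈ cuspidalSubspace n E μ) : galL2 F hμ σ f ∈ cuspidalSubspace n E μ := by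
  have hmaps : Set.MapsTo (galL2 F hμ σ)
      (LinearMap.range (cuspFormsToLp n E μ) : Set ((gl n E).L2 μ))
      (LinearMap.range (cuspFormsToLp n E μ) : Set ((gl n E).L2 μ)) :=
    fun f hf => galL2_mem_range_cuspFormsToLp F μ hμ σ hf
  have hcl := hmaps.closure (galL2 F hμ σ).continuous
  have hf' : f ∈ closure (LinearMap.range (cuspFormsToLp n E μ) : Set ((gl n E).L2 μ)) := by
    rw [← Submodule.topologicalClosure_coe]; exact hf
  have := hcl hf'
  rw [← Submodule.topologicalClosure_coe] at this
  exact this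

/-- **The Galois conjugate of a subrepresentation of `L²_cusp` lies in `L²_cusp`.** [folklore] -/
theorem galConj_le_cuspidalSubspace {W : ContRepresentation.ClosedSubrep ((gl n E).rightRegular μ)}
    (hW : W ≤ cuspidalSubspace n E μ) (hμ : IsGalInvariant F μ) (σ : E ≃ₐ[F] E) :
    W.galConj hμ σ ≤ cuspidalSubspace n E μ := by
  intro f hf
  rw [ContRepresentation.ClosedSubrep.mem_galConj_iff] at hf
  have := galL2_mem_cuspidalSubspace F μ hμ σ (hW hf)
  rwa [galL2_galL2_inv] at this

variable {μ} in
/-- **The Galois conjugate of a cuspidal automorphic representation** `Π` of `GL_n(𝔸_E)`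
(`σ ∈ Aut(E/F)`, `μ` a `Gal`-invariant automorphic measure): the closed irreducible subspace
`U_σ(Π) ≤ L²_cusp` (`ClosedSubrep.galConj`; cuspidality by `galConj_le_cuspidalSubspace`), on which
`R(g)` acts as `R(σ⁻¹ g)` does on `Π`, i.e. `U_σ(Π) ≅ Π ∘ σ⁻¹` — the representation `Π^{σ⁻¹}` in
Arthur–Clozel's notation `Π^σ(g) := Π(σ g)` (*Simple algebras, base change, and the advanced theory
of the trace formula*, Ch. 1 §2.1); `σ ↦ U_σ(Π)` is a left action of `Aut(E/F)` running through the
Galois orbit of `Π`. [cite: ArthurClozelAMS120, Ch. 1 §2.1 (`Π^σ`, `σ`-stable)] -/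
def CuspidalAutomorphicRepGL.galConj (P : CuspidalAutomorphicRepGL n E μ) (hμ : IsGalInvariant F μ)
    (σ : E ≃ₐ[F] E) : CuspidalAutomorphicRepGL n E μ :=
  ⟨P.1.galConj hμ σ, galConj_le_cuspidalSubspace F μ P.2.1 hμ σ,
    (P.1.isTopIrreducible_galConj_iff F hμ σ).mpr P.2.2⟩

variable {μ}

/-- The underlying closed subrepresentation of `P.galConj hμ σ` is `P.1.galConj hμ σ`
(definitional). [folklore] -/
@[simp] theorem CuspidalAutomorphicRepGL.galConj_val (P : CuspidalAutomorphicRepGL n E μ)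
    (hμ : IsGalInvariant F μ) (σ : E ≃ₐ[F] E) : (P.galConj F hμ σ).1 = P.1.galConj hμ σ := rfl

/-- `Π^1 = Π`. [folklore] -/
@[simp] theorem CuspidalAutomorphicRepGL.galConj_one (P : CuspidalAutomorphicRepGL n E μ)
    (hμ : IsGalInvariant F μ) : P.galConj F hμ 1 = P :=
  Subtype.ext (P.1.galConj_one F hμ)

/-- `(Π^τ)^σ = Π^{σ τ}`. [folklore] -/
theorem CuspidalAutomorphicRepGL.galConj_galConj (P : CuspidalAutomorphicRepGL n E μ)
    (hμ : IsGalInvariant F μ) (σ τ : E ≃ₐ[F] E) :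
    (P.galConj F hμ τ).galConj F hμ σ = P.galConj F hμ (σ * τ) :=
  Subtype.ext (P.1.galConj_galConj F hμ σ τ)

/-- **`Π` is `σ`-stable**: `U_σ(Π) = Π` as subspaces of `L²_cusp` (where cuspidal representations
of `GL_n` occur with multiplicity one). Arthur–Clozel (Ch. 1 §2.1, and Ch. 3 Thm. 4.2 "`σ`-stable",
"`Π ≅ Π ∘ σ`") call `Π` `σ`-stable if `Π ≅ Π^σ := Π ∘ σ`; since `U_σ(Π) ≅ Π ∘ σ⁻¹`, `IsGalStable … σ`
renders their `σ⁻¹`-stability, and stability for *all* `σ` (the form used in every statement, and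
equivalent to stability under a generator for `E/F` of prime degree, `isGalStable_mul`) is the
same in both conventions. [cite: ArthurClozelAMS120, Ch. 1 §2.1 (`Π^σ`, `σ`-stable)] -/
def CuspidalAutomorphicRepGL.IsGalStable (P : CuspidalAutomorphicRepGL n E μ) (hμ : IsGalInvariant F μ)
    (σ : E ≃ₐ[F] E) : Prop :=
  P.galConj F hμ σ = P

/-- `Π` is `1`-stable. [folklore] -/
theorem CuspidalAutomorphicRepGL.isGalStable_one (P : CuspidalAutomorphicRepGL n E μ)
    (hμ : IsGalInvariant F μ) : P.IsGalStable F hμ 1 :=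
  P.galConj_one F hμ

/-- For `E/F` of prime degree, stability under one non-trivial `σ` is stability under all of
`Gal(E/F)` (a group of prime order is generated by any non-trivial element); recorded in the
general form: the stabiliser is a subgroup. [folklore] -/
theorem CuspidalAutomorphicRepGL.isGalStable_mul {P : CuspidalAutomorphicRepGL n E μ}
    {hμ : IsGalInvariant F μ} {σ τ : E ≃ₐ[F] E} (hσ : P.IsGalStable F hμ σ) (hτ : P.IsGalStable F hμ τ) :
    P.IsGalStable F hμ (σ * τ) := by
  unfold CuspidalAutomorphicRepGL.IsGalStable at *
  rw [← P.galConj_galConj F hμ σ τ, hτ, hσ]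

end CuspForms

/-! ## Hecke operators under conjugate-equivariant isomorphisms (generic) -/

section HeckeConj

variable {k G V V' : Type*} [CommRing k] [Group G]
  [AddCommGroup V] [TopologicalSpace V] [IsTopologicalAddGroup V] [Module k V]
  [AddCommGroup V'] [TopologicalSpace V'] [IsTopologicalAddGroup V'] [Module k V']
  {π : ContRepresentation k G V} {π' : ContRepresentation k G V'}
  {e : V ≃L[k] V'} {θ : G ≃* G}

/-- The bijection `G ⧸ K → G ⧸ θ(K)` of coset spaces induced by a group automorphism `θ`. [folklore] -/
def quotientMapOfMulEquiv (θ : G ≃* G) (K : Subgroup G) : G ⧸ K → G ⧸ K.map θ.toMonoidHom :=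
  Quotient.map' θ fun a b h => by
    rw [QuotientGroup.leftRel_apply] at h ⊢
    exact ⟨a⁻¹ * b, h, by simp⟩

/-- `Θ [x] = [θ x]` (definitional). [folklore] -/
@[simp] theorem quotientMapOfMulEquiv_mk (θ : G ≃* G) (K : Subgroup G) (x : G) :
    quotientMapOfMulEquiv θ K (x : G ⧸ K) = ((θ x : G) : G ⧸ K.map θ.toMonoidHom) := rfl

/-- `Θ` is injective. [folklore] -/
theorem quotientMapOfMulEquiv_injective (θ : G ≃* G) (K : Subgroup G) :
    Function.Injective (quotientMapOfMulEquiv θ K) := by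
  intro x y
  induction x using Quotient.inductionOn' with
  | h a =>
    induction y using Quotient.inductionOn' with
    | h b =>
      intro h
      change ((θ a : G) : G ⧸ K.map θ.toMonoidHom) = ((θ b : G) : G ⧸ K.map θ.toMonoidHom) at h
      change (a : G ⧸ K) = (b : G ⧸ K)
      rw [QuotientGroup.eq] at h ⊢
      obtain ⟨c, hc, hc'⟩ := h
      have : c = a⁻¹ * b := θ.injective (by rw [map_mul, map_inv]; exact hc')
      rwa [this] at hc

/-- `Θ` is surjective. [folklore] -/
theorem quotientMapOfMulEquiv_surjective (θ : G ≃* G) (K : Subgroup G) :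
    Function.Surjective (quotientMapOfMulEquiv θ K) := by
  intro y
  induction y using Quotient.inductionOn' with
  | h b => exact ⟨(θ.symm b : G), by simp [quotientMapOfMulEquiv_mk]; rfl⟩

/-- `Θ (κ • y) = θ(κ) • Θ y` for `κ ∈ K`. [folklore] -/
theorem quotientMapOfMulEquiv_smul (θ : G ≃* G) (K : Subgroup G) (κ : K) (y : G ⧸ K) :
    quotientMapOfMulEquiv θ K (κ • y) =
      (⟨θ κ, ⟨κ, κ.2, rfl⟩⟩ : K.map θ.toMonoidHom) • quotientMapOfMulEquiv θ K y := by
  induction y using Quotient.inductionOn' with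
  | h b =>
    change ((θ ((κ : G) * b) : G) : G ⧸ K.map θ.toMonoidHom) = (((θ κ : G) * θ b : G) : G ⧸ _)
    rw [map_mul]

/-- `Θ` maps the `K`-orbit of `[g]` onto the `θ(K)`-orbit of `[θ g]`. [folklore] -/
theorem image_quotientMapOfMulEquiv_orbit (θ : G ≃* G) (K : Subgroup G) (g : G) :
    quotientMapOfMulEquiv θ K '' MulAction.orbit K (g : G ⧸ K) =
      MulAction.orbit (K.map θ.toMonoidHom) ((θ g : G) : G ⧸ K.map θ.toMonoidHom) := by
  ext y
  constructor
  · rintro ⟨_, ⟨κ, rfl⟩, rfl⟩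
    rw [quotientMapOfMulEquiv_smul, quotientMapOfMulEquiv_mk]
    exact MulAction.mem_orbit _ _
  · rintro ⟨⟨_, ⟨κ, hκ, rfl⟩⟩, rfl⟩
    refine ⟨(⟨κ, hκ⟩ : K) • (g : G ⧸ K), MulAction.mem_orbit _ _, ?_⟩
    rw [quotientMapOfMulEquiv_smul, quotientMapOfMulEquiv_mk]
    rfl

/-- The orbit of `[θ g]` under `θ(K)` is finite iff the orbit of `[g]` under `K` is. [folklore] -/
theorem finite_orbit_map_iff (θ : G ≃* G) (K : Subgroup G) (g : G) :
    (MulAction.orbit (K.map θ.toMonoidHom) ((θ g : G) : G ⧸ K.map θ.toMonoidHom)).Finite ↔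
      (MulAction.orbit K (g : G ⧸ K)).Finite := by
  rw [← image_quotientMapOfMulEquiv_orbit]
  exact Set.finite_image_iff (quotientMapOfMulEquiv_injective θ K).injOn

/-- If the orbit `K · gK ⊆ G ⧸ K` (i.e. the double coset `KgK/K`) is infinite, the (junk) Hecke
operator `[KgK]` vanishes: every summand `ρ(y)` is invertible, hence non-zero on a non-trivial
`V`, so the `finsum` has infinite support. (Same statement as
`heckeOperator_eq_zero_of_infinite` of `JacquetLanglandsParts`, repeated here to keep this file
free of the quaternionic import, and `private` to avoid a second public name; librarian: both
belong next to `heckeOperator` in `HeckeAlgebra`.) [folklore] -/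
private theorem heckeOperator_eq_zero_of_infinite_orbit {k G V : Type*} [CommRing k] [Group G]
    [AddCommGroup V] [Module k V] (ρ : Representation k G V) (K : Subgroup G) (g : G)
    (hK : (MulAction.orbit K (g : G ⧸ K)).Infinite) : Literature.NumberTheory.Automorphic.heckeOperator ρ K g = 0 := by
  rcases subsingleton_or_nontrivial V with hV | hV
  · exact LinearMap.ext fun v => Subsingleton.elim _ _
  rw [Literature.NumberTheory.Automorphic.heckeOperator]
  apply finsum_mem_eq_zero_of_infinite
  rw [Set.inter_eq_self_of_subset_left]
  · exact hK
  · intro y _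
    rw [Function.mem_support]
    intro h0
    obtain ⟨w, hw⟩ := exists_ne (0 : V)
    apply hw
    have : ρ y.out w = 0 := by rw [h0, LinearMap.zero_apply]
    simpa using congrArg (ρ y.out⁻¹) this

/-- **Hecke operators under a `θ`-conjugate equivariant isomorphism**: on `K`-fixed vectors,
`[θK · θg · θK] (e f) = e ([K g K] f)`. [folklore] -/
theorem heckeOperatorAt_mapConj_mapConjEquiv (W : ContRepresentation.ClosedSubrep π)
    (he : ContRepresentation.ClosedSubrep.IsConjEquivariant π π' e θ)
    (K : Subgroup G) (g : G) {f : W.toSubmodule} (hf : f ∈ W.fixedVectors K) :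
    Literature.NumberTheory.Automorphic.heckeOperatorAt (W.mapConj he) (K.map θ.toMonoidHom) (θ g) (W.mapConjEquiv he f) =
      W.mapConjEquiv he (Literature.NumberTheory.Automorphic.heckeOperatorAt W K g f) := by
  classical
  by_cases hfin : (MulAction.orbit K (g : G ⧸ K)).Finite
  · -- a transversal `s` of `KgK/K`, and its image `θ s`, a transversal of `θK θg θK / θK`
    set s : Finset G := hfin.toFinset.image Quotient.out with hs
    have hbij : Set.BijOn (fun x : G => (x : G ⧸ K)) s (MulAction.orbit K (g : G ⧸ K)) := by
      refine ⟨?_, ?_, ?_⟩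
      · intro x hx
        obtain ⟨y, hy, rfl⟩ := Finset.mem_image.1 hx
        rw [Set.Finite.mem_toFinset] at hy
        simpa only [QuotientGroup.out_eq'] using hy
      · intro x hx x' hx' h
        obtain ⟨y, -, rfl⟩ := Finset.mem_image.1 hx
        obtain ⟨y', -, rfl⟩ := Finset.mem_image.1 hx'
        simp only [QuotientGroup.out_eq'] at h
        rw [h]
      · intro y hy
        refine ⟨y.out, Finset.mem_image.2 ⟨y, (Set.Finite.mem_toFinset _).2 hy, rfl⟩, ?_⟩
        exact QuotientGroup.out_eq' y
    have hbij' : Set.BijOn (fun x : G => (x : G ⧸ K.map θ.toMonoidHom)) (s.image θ)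
        (MulAction.orbit (K.map θ.toMonoidHom) ((θ g : G) : G ⧸ K.map θ.toMonoidHom)) := by
      rw [← image_quotientMapOfMulEquiv_orbit, ← hbij.image_eq, Finset.coe_image, Set.image_image]
      refine ⟨?_, ?_, ?_⟩
      · rintro _ ⟨x, hx, rfl⟩
        exact ⟨x, hx, rfl⟩
      · rintro _ ⟨x, hx, rfl⟩ _ ⟨x', hx', rfl⟩ h
        have h' : quotientMapOfMulEquiv θ K (x : G ⧸ K) = quotientMapOfMulEquiv θ K (x' : G ⧸ K) := h
        have := quotientMapOfMulEquiv_injective θ K h'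
        rw [hbij.injOn hx hx' this]
      · rintro _ ⟨x, hx, rfl⟩
        exact ⟨θ x, ⟨x, hx, rfl⟩, rfl⟩
    have hf' := (W.mapConjEquiv_mem_fixedVectors_iff he K f).mpr hf
    rw [Literature.NumberTheory.Automorphic.heckeOperatorAt, Literature.NumberTheory.Automorphic.heckeOperatorAt,
      Literature.NumberTheory.Automorphic.heckeOperator_apply_eq_sum _ _ _ _ hbij' hf',
      Literature.NumberTheory.Automorphic.heckeOperator_apply_eq_sum _ _ _ _ hbij hf, map_sum,
      Finset.sum_image fun x _ y _ h => θ.injective h]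
    refine Finset.sum_congr rfl fun x _ => ?_
    exact (W.isConjEquivariant_mapConjEquiv he x f).symm
  · have hinf : (MulAction.orbit K (g : G ⧸ K)).Infinite := hfin
    have hinf' : (MulAction.orbit (K.map θ.toMonoidHom) ((θ g : G) : G ⧸ K.map θ.toMonoidHom)).Infinite :=
      fun h => hfin ((finite_orbit_map_iff θ K g).mp h)
    rw [Literature.NumberTheory.Automorphic.heckeOperatorAt, Literature.NumberTheory.Automorphic.heckeOperatorAt,
      heckeOperator_eq_zero_of_infinite_orbit _ _ _ hinf,
      heckeOperator_eq_zero_of_infinite_orbit _ _ _ hinf', LinearMap.zero_apply,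
      LinearMap.zero_apply, map_zero]

end HeckeConj

/-! ## Satake parameters of `Π^σ` and base change -/

section Satake

open NumberField AdelicGroupData MeasureTheory IsDedekindDomain

variable (F : Type*) [Field F] {E : Type} [Field E] [NumberField E] [Algebra F E] {n : ℕ}
variable {ν : Measure (gl n E).automorphicQuotient}
  [SMulInvariantMeasure (gl n E).Adelic (gl n E).automorphicQuotient ν]

/-- `σ • K(𝔑) = K(σ • 𝔑)` for principal congruence subgroups. [folklore] -/
theorem map_principalCongruenceLevel (σ : E ≃ₐ[F] E) (𝔑 : Ideal (𝓞 E)) :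
    (principalCongruenceLevel n E 𝔑).map (MulDistribMulAction.toMulEquiv (gl n E).Adelic σ).toMonoidHom =
      principalCongruenceLevel n E (σ • 𝔑) := by
  ext g
  constructor
  · rintro ⟨x, hx, rfl⟩
    exact (GLn.smul_mem_principalCongruenceLevel_iff F σ 𝔑 x).mpr hx
  · intro hg
    refine ⟨σ⁻¹ • g, ?_, smul_inv_smul σ g⟩
    have := (GLn.smul_mem_principalCongruenceLevel_iff F σ⁻¹ (σ • 𝔑) g).mpr hg
    rwa [inv_smul_smul] at this

/-- The residue cardinality is Galois-invariant: `q_{σ w} = q_w`. [folklore] -/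
theorem residueCard_smul (σ : E ≃ₐ[F] E) (w : HeightOneSpectrum (𝓞 E)) :
    (σ • w).residueCard = w.residueCard :=
  HeightOneSpectrum.absNorm_algEquiv_smul F σ w

/-- **Satake parameters of the Galois conjugate.** If `W ≤ L²` has Satake parameter `α` at `w`
with respect to the level `Kf` and the uniformizer `ϖ`, then `W^σ = U_σ(W)` has Satake
parameter `α` at `σ w` with respect to `σ(Kf)` and `σ_w(ϖ)`: `U_σ` carries the `Kf`-fixed
Hecke eigenvector to a `σ(Kf)`-fixed one with `[σKf · σ t_{w,i} · σKf] = [σKf · t_{σw,i}(σ_w ϖ) · σKf]`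
acting by the same scalars, and `q_{σ w} = q_w`. In terms of Hecke matrices, `t_{U_σ(Π), σ w} = t_{Π, w}`,
i.e. `t_{Π^τ, w} = t_{Π, τ w}` for `Π^τ := Π ∘ τ` (Arthur–Clozel's notation, Ch. 1 §2.1; `τ = σ⁻¹`).
[folklore] -/
theorem HasSatakeParameterAt.galConj {W : ContRepresentation.ClosedSubrep ((gl n E).rightRegular ν)}
    {Kf : Subgroup (gl n E).Adelic} {w : HeightOneSpectrum (𝓞 E)} {ϖ : (w.adicCompletion E)ˣ}
    {α : Multiset ℂ} (h : HasSatakeParameterAt W Kf w ϖ α) (hν : IsGalInvariant F ν) (σ : E ≃ₐ[F] E) :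
    HasSatakeParameterAt (W.galConj hν σ)
      (Kf.map (MulDistribMulAction.toMulEquiv (gl n E).Adelic σ).toMonoidHom) (σ • w)
      (galAdicCompletionUnitsEquiv σ rfl ϖ) α := by
  obtain ⟨hϖ, hcard, f, hf, hf0, hT⟩ := h
  have he := isConjEquivariant_galL2Equiv F hν σ
  refine ⟨(valued_galAdicCompletionUnitsEquiv E σ rfl ϖ).trans hϖ, hcard, W.mapConjEquiv he f,
    (W.mapConjEquiv_mem_fixedVectors_iff he Kf f).mpr hf, ?_, fun i hi => ?_⟩
  · exact fun h0 => hf0 ((W.mapConjEquiv he).injective (h0.trans (map_zero _).symm))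
  · have key := heckeOperatorAt_mapConj_mapConjEquiv W he Kf (heckeDiagAt n E w ϖ i) hf
    have hσt : (MulDistribMulAction.toMulEquiv (gl n E).Adelic σ) (heckeDiagAt n E w ϖ i) =
        heckeDiagAt n E (σ • w) (galAdicCompletionUnitsEquiv σ rfl ϖ) i :=
      GLn.smul_heckeDiagAt F σ w ϖ i
    rw [hσt] at key
    refine key.trans ?_
    rw [hT i hi, map_smul, residueCard_smul]
    rfl

/-- **Satake parameters of `U_σ(W)` at principal congruence levels**: `W` has parameter `α` at
`w` for `K(𝔑)` ⇒ `U_σ(W)` has parameter `α` at `σ w` for `K(σ 𝔑)`. [folklore] -/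
theorem HasSatakeParameterAt.galConj_principalCongruenceLevel
    {W : ContRepresentation.ClosedSubrep ((gl n E).rightRegular ν)} {𝔑 : Ideal (𝓞 E)}
    {w : HeightOneSpectrum (𝓞 E)} {ϖ : (w.adicCompletion E)ˣ} {α : Multiset ℂ}
    (h : HasSatakeParameterAt W (principalCongruenceLevel n E 𝔑) w ϖ α) (hν : IsGalInvariant F ν)
    (σ : E ≃ₐ[F] E) :
    HasSatakeParameterAt (W.galConj hν σ) (principalCongruenceLevel n E (σ • 𝔑)) (σ • w)
      (galAdicCompletionUnitsEquiv σ rfl ϖ) α := by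
  rw [← map_principalCongruenceLevel F σ 𝔑]
  exact h.galConj F hν σ

/-- **Descent form**: a Satake parameter of `W^σ` at `w` (level `K(𝔑)`, uniformizer `ϖ'`) is a
Satake parameter of `W` at `σ⁻¹ w` (level `K(σ⁻¹ 𝔑)`, uniformizer `σ⁻¹_w ϖ'`). [folklore] -/
theorem HasSatakeParameterAt.of_galConj
    {W : ContRepresentation.ClosedSubrep ((gl n E).rightRegular ν)} {𝔑 : Ideal (𝓞 E)}
    {w : HeightOneSpectrum (𝓞 E)} {ϖ' : (w.adicCompletion E)ˣ} {β : Multiset ℂ}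
    (hν : IsGalInvariant F ν) (σ : E ≃ₐ[F] E)
    (h : HasSatakeParameterAt (W.galConj hν σ) (principalCongruenceLevel n E 𝔑) w ϖ' β) :
    HasSatakeParameterAt W (principalCongruenceLevel n E (σ⁻¹ • 𝔑)) (σ⁻¹ • w)
      (galAdicCompletionUnitsEquiv σ⁻¹ rfl ϖ') β := by
  have := h.galConj_principalCongruenceLevel F hν σ⁻¹
  rwa [ContRepresentation.ClosedSubrep.galConj_inv_galConj] at this

end Satake

end Literature.NumberTheory.Automorphic

/-! ## Weak base change and Galois conjugation -/

namespace Literature.NumberTheory.Automorphic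

open NumberField IsDedekindDomain MeasureTheory Filter AdelicGroupData

section BaseChange

variable {n : ℕ} {F E : Type} [Field F] [NumberField F] [Field E] [NumberField E] [Algebra F E]
variable {μ : Measure (gl n F).automorphicQuotient}
  [SMulInvariantMeasure (gl n F).Adelic (gl n F).automorphicQuotient μ]
  {ν : Measure (gl n E).automorphicQuotient}
  [SMulInvariantMeasure (gl n E).Adelic (gl n E).automorphicQuotient ν]

/-- **Galois conjugates of weak base-change lifts are weak base-change lifts**: if `Π` is a
weak lift of `π` then so is `U_σ(Π)` for every `σ ∈ Aut(E/F)`, because `σ w` lies over the same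
place `v` of `F` as `w`, with the same residue degree, and `t_{U_σ(Π), σ w} = t_{Π, w} = t_{π,v}^{f}`
(Arthur–Clozel, Ch. 3, Prop. 4.4 (iii): "if `Π` lifts `π`, then `Π^τ` lifts `π^τ`", here with
`τ ∈ Gal(E/F)`, so that `π^τ = π`; the statement is the same for `Π^τ = Π ∘ τ` and for
`U_σ(Π) ≅ Π ∘ σ⁻¹`). [cite: ArthurClozelAMS120, Ch. 3 Prop. 4.4 (iii)] -/
theorem IsWeakBaseChangeLift.galConj
    {W : ContRepresentation.ClosedSubrep ((gl n F).rightRegular μ)}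
    {W' : ContRepresentation.ClosedSubrep ((gl n E).rightRegular ν)}
    (h : IsWeakBaseChangeLift W W') (hν : IsGalInvariant F ν) (σ : E ≃ₐ[F] E) :
    IsWeakBaseChangeLift W (W'.galConj hν σ) := by
  intro 𝔫 𝔑
  have h' := (tendsto_inv_smul_cofinite (B := 𝓞 E) (G := E ≃ₐ[F] E) σ).eventually (h 𝔫 (σ⁻¹ • 𝔑))
  filter_upwards [h'] with w hw ϖ ϖ' α β hα hβ
  have hβ' := HasSatakeParameterAt.of_galConj F hν σ hβ
  obtain ⟨ϖ₀, hα'⟩ : ∃ ϖ₀ : (((σ⁻¹ • w).under (𝓞 F)).adicCompletion F)ˣ,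
      HasSatakeParameterAt W (principalCongruenceLevel n F 𝔫) ((σ⁻¹ • w).under (𝓞 F)) ϖ₀ α := by
    have hu : w.under (𝓞 F) = (σ⁻¹ • w).under (𝓞 F) :=
      (HeightOneSpectrum.under_algEquiv_smul F E σ⁻¹ w).symm
    clear hβ hβ' hw ϖ'
    revert ϖ
    rw [hu]
    exact fun ϖ hα => ⟨ϖ, hα⟩
  have := hw ϖ₀ _ α β hα' hβ'
  rwa [HeightOneSpectrum.inertiaDeg_algEquiv_smul] at this

/-- `IsWeakBaseChangeLift` is invariant under `σ` on the target: `Π^σ` lifts `π` iff `Π` does.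
[folklore] -/
theorem isWeakBaseChangeLift_galConj_iff
    {W : ContRepresentation.ClosedSubrep ((gl n F).rightRegular μ)}
    {W' : ContRepresentation.ClosedSubrep ((gl n E).rightRegular ν)}
    (hν : IsGalInvariant F ν) (σ : E ≃ₐ[F] E) :
    IsWeakBaseChangeLift W (W'.galConj hν σ) ↔ IsWeakBaseChangeLift W W' := by
  refine ⟨fun h => ?_, fun h => h.galConj hν σ⟩
  have := h.galConj hν σ⁻¹
  rwa [ContRepresentation.ClosedSubrep.galConj_inv_galConj] at this

/-- **Arthur–Clozel, Ch. 3, Thm. 4.2 (d), existence half (descent of `σ`-stable cuspidal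
representations; named fact).** Let `E/F` be a cyclic extension of number fields of prime
degree and `Π` a cuspidal automorphic representation of `GL_n(𝔸_E)` which is `σ`-stable
(`Π^σ = Π`) for a generator — equivalently every element — `σ` of `Gal(E/F)`. Then there is a
cuspidal automorphic representation `π` of `GL_n(𝔸_F)` of which `Π` is a weak base-change lift.
(Op. cit.: "Assume `Π` is cuspidal, `Π ≅ Π ∘ σ`. Then there is `π` cuspidal lifting to `Π`";
the remaining clauses of (d) — all such `π` are of the form `π ⊗ ηⁱ` and satisfy
`π ≇ π ⊗ η` — involve the class-field character `η` of `E/F` and are not stated here.) Rendering: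
"`Π ≅ Π ∘ σ`" is `IsGalStable` for every `σ ∈ Aut(E/F)` (convention-independent, and for prime
degree equivalent to stability under a generator); the descended `π` lives in
`L²(GL_n(𝔸_F) ⧸ A_G GL_n(F))`, consistently with (d), since `Π` is trivial on `A_G(E) ⊇ A_G(F)`
and the lift relation only constrains Hecke eigenvalues. The proof in print is the comparison of
trace formulas (4.1) = (4.2), Ch. 2 (17.8), with the `L`-function argument of Ch. 3 §4.
[cite: ArthurClozelAMS120, Ch. 3, Thm. 4.2 (d)] -/
def ArthurClozel1989_exists_cuspidal_descent_of_isGalStable : Prop :=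
  ∀ [IsGalois F E] (_hℓ : (Module.finrank F E).Prime)
    (ν' : Measure (gl n E).automorphicQuotient) [(gl n E).IsAutomorphicMeasure ν']
    (hν' : IsGalInvariant F ν') (Q : CuspidalAutomorphicRepGL n E ν')
    (_hQ : ∀ σ : E ≃ₐ[F] E, Q.IsGalStable F hν' σ),
    ∃ (μ' : Measure (gl n F).automorphicQuotient) (_ : (gl n F).IsAutomorphicMeasure μ')
      (P : CuspidalAutomorphicRepGL n F μ'), IsWeakBaseChangeLift P.1 Q.1

end BaseChange

end Literature.NumberTheory.Automorphic
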